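import Literature.MathematicalPhysics.QuantumFieldTheory.Balaban1983to89.B2Ineq2109HiggsLatticeTower
import Literature.MathematicalPhysics.QuantumFieldTheory.Balaban1983to89.B2Eq245ThetaNonzero

/-!
# `Balaban1983to89.B2Eq298RegularOmega` — [Balaban1982Higgs2] **(2.98) p. 577 / p. 579** ON THE (Higgs)₂,₃ CARRIER OF RECORD: the
# regularity (I.2.23) of the external vector field of the basic quadratic form ON THE WHOLE REGION `Ω_k = Bᵏ(Λ₂^{(k−1)′}) = B^{k−1}(Λ₂^{(k−1)})`
# of (2.87)/(2.108)/(3.5), DERIVED for the constructed Prop-3.1 datum (gen 13's `B2Prop31MinimizerRegionsN.RegionsDataN`: regions = the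
# typer's tower (2.7)–(2.8)/(2.43), minimizers (3.3), cut-offs `ζ^{(k)}` (2.44), printed restrictions (2.55)) by the printed mechanism
# (2.95)–(2.98) — and with it THE LAST STANDING HYPOTHESIS `TowerData.Reg` of gen 15's `B2Ineq2109HiggsLatticeTower` DISCHARGED: the
# (2.108)–(2.109) = (3.8) bounds, (2.109)₂ and the (2.108) error term hold for the datum's steps with their GENUINE §3 field `Ã^ε`

statement-level skeleton of published theorems with citation tags; proofs where landed; nothing here is a claim about the Yang–Mills mass gap

PDF held: `paper:balaban1982-cmp86-higgs23-ii` (T. Bałaban, *(Higgs)₂,₃ quantum fields in a finite volume. II. An upper bound*, Commun.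
Math. Phys. **86** (1982) 555–594, doi 10.1007/bf01214890 [Balaban1982Higgs2]; journal page = PDF page + 554); pp. 567, 569, 575–577,
579–580, 583 [PDF 13, 15, 21–23, 25–26, 29] READ AS IMAGES on the ×2 renders
`run/shared/lean/pub/pub-balaban/b2b-balaban-ref1/pages/1982-cmp86-higgs23-II/1982-cmp86-higgs23-II-p0NN-x2.png` (re-read by this seat 2026-08-22);
part I = [Balaban1982Higgs1] (`paper:balaban1982-cmp85-higgs23-i`, journal page = PDF page + 602) (2.23) p. 610.

CITATION HEADER (lean-in-tree rule).  Cell `lit-balaban` (HOME `run/shared/lean/pub/lit-balaban/`), Phase-2 proof seat **p23** gen 16 (unit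
`lit-balaban-p23-g16`; TAKING line HOME/STATUS.md 2026-08-22T11:56:30Z; v1.2 (gen 20) DOC-ONLY: «(1.16)–(1.20) p.607» → «pp.606–607»
and «(2.21) p.560» → «p.561» ×3, summit-lit1 CITELOC P79-001 / P79-002).  SKELETON rows **B2.Eq2.87-2.98** (member (2.98); head `proved
p272450 · …`, files of record p15's `B2Eq293ExternalField` — (2.93)–(2.98) as kernel theorems over printed-shape HYPOTHESES), **B2.Eq2.109**
((2.108)–(2.109) p. 580; decl of record `B2Sect2Statements.Ineq2109`), **B2.Eq3.1-3.10** ((3.8) `B2Sect3AStatements.Ineq38`) — CELLS ONLY, no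
head claim; fold owner r02, second reader r14, referee ref-4.  USED BY NAME, NOTHING RESTATED: gen 15 `B2Ineq2109HiggsLatticeTower.{TowerData,
TowerData.toInst, TowerData.Reg, TowerData.adm_toInst, TowerData.mem_Ω, TowerIdx, abs_hk_le_tower, abs_form_hk_le_tower}` (p326609) and
`B2Ineq2109HiggsLattice.{Inst, Adm, ineq2109_pow_higgsLattice, gam, c227, c229}` (p325417); gen 13 `B2Prop31MinimizerRegionsN.{RMultiMRN,
RMultiMRN.A/.field/.restrictedM/.restricted_toRMultiP, RegionsDataN, RegionsDataN.toRMultiMRN/.tower, radN, exp_neg_delta_radN_le,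
radN_ge_mul_u, dataTowerN}` (p320781), `B2Prop31MinimizerRegions.{lemma23_thresholds_rad, towerRad, towerRad_eq, towerRad_nonneg}` (p319405),
`B2Eq245Theta.{thetaOf, thetaOf_eq_one_of_mem, mem_plateau, RegionsDataN.ofFields}` (p321142); gen 11 `B2Prop31MinimizerFamily.{MinConsts,
Lemma23Bounds, toConsts, c3Of, c5Of}` (p314111); gen 10 `B2Eq32FieldRegularity.{field32, field32_apply, field32_regular_slice}` (p309492),
`B2Prop31PrintedRestrictions.{RMultiP, hreg_of_restricted}` (p310287), `B2Prop31Thresholds.{Consts, thr259, thr260, thr217, deltaReg, deltaReg_eq,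
thr259_anti, thr260_anti, CmS, sq_Lk_deltaReg, pFn_sq}`; the typer's `B2Eq243RegionsTower.{towerRegion, towerOf_lam_of_lt, towerRegion_antitone,
towerRegion_blockOf_congr, mem_seven_of_blockOf_mem_succ}`; p15's `B2Eq324NestedRegions.{prime, Tower, Tower.lamAt, lamAt_anti, not_lamAt_top,
inPiece_regions_iff}`, `B2Eq328ConcretePieces.pieceF`; r02's `B2Sect3AGaussianStep.one_add_log_inv_rpow_mul_rpow_le`; r14's Lemma 2.3 on the
carrier enters through `Lemma23Bounds` (inhabited by `B2Lemma23HiggsLattice`, p312208, via `exists_lemma23Bounds`).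

WHAT IS PRINTED (verbatim, renders read as images).  p. 576 [PDF 22]: *"We will need to apply Propositions I.2.1–I.2.3 to operators with
external vector field equal to (2.93), so we have to verify the assumption of regularity (I.2.23) for this field. […] Let us consider the
remaining part of the expression (2.93) and let us denote it by B̃. The derivative (∂^{L^{−j}}_μB̃)(x) of this configuration is equal to one
of the derivatives (∂^{L^{−j}}_μA^{(l),L^{−j}})(x) or to (∂^{L^{−j}}_μB^{(k+1),L^{−j}})(x) if the point x does not lie in a slice of thickness M
surrounding one of the sets Bˡ(Λ₂^{(l)}). […] (2.95) If x belongs to this slice, then the above inequality implies (∂B̃)(x) =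
(∂(1 − θ_{l+1})A^{(l)})(x) + (∂θ_{l+1}A^{(l+1)})(x) = (∂θ_{l+1})(x)(A^{(l+1)}(x) − A^{(l)}(x)) + O(p(Lʲε)),  (2.96) and applying Lemma 2.3,
we have A^{(l+1)}(x) − A^{(l)}(x) = A_{l+1}(y′) − A_l(y) + (L^{j−l})^{(d−2)/2}O(p(Lˡε)),  (2.97)"*; p. 577 [PDF 23]: *"where x ∈ B^{l+1}(y′),
x ∈ Bˡ(y), thus y ∈ B(y′) and the restrictions on the fields A_l, A_{l+1} on the set Λ₀^{(l)} imply A_{l+1}(y′) − A_l(y) =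
(L^{j−l})^{(d−2)/2}O(p(Lˡε)) again. These inequalities give us finally |(∂^{L^{−j}}_μB̃)(x)| ≦ O(1)p(Lʲε),  (2.98) and it means that the
regularity assumption is satisfied for the configurations B̃ and (2.93)."*; p. 579 [PDF 25]: *"Again let us notice that the propagator
G_k(Bᵏ(Λ₀^{(k)}), B̃) depends on the configuration Bᵏ(Λ₀^{(k)})B̃ = Bᵏ(Λ₀^{(k)})(1 − θ_{k+1})A^{(k)} + θ_{k+1}B^{(k+1),η} and this configuration
satisfies the regularity assumption of Proposition I.2.1 on the basis of the estimate (2.98). […] The interaction terms we get after these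
expansions and estimates contain the propagator G_k(B^{k−1}(Λ₂^{(k−1)}), B̃)."*; p. 567 [PDF 13]: *"The function θ_k is defined on T_η, is equal
to 1 on B^{k−1}(Λ₂^{(k−1)}) and varies "smoothly" from 1 to 0 on a slice of thickness < M surrounding B^{k−1}(Λ₂^{(k−1)})."*; p. 583 [PDF 29]:
(3.2) *"Ã^ε = (1 − θ₁)A₀ + Σ_{k=1}^{K−1}(1 − θ_{k+1})θ_kA^{(k),ε} + θ_KA^{(K),ε}"*, (3.5): the forms *"⟨(Λ₆^{(k−1)′}∩Λ₃^{(k)c})φ_k,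
Δ^{(k),Lᵏε}(Bᵏ(Λ₂^{(k−1)′}∩Λ₅^{(k)c}), Ã^{(k),ε})(…)φ_k⟩"*, *"⟨Λ₃^{(k)}φ_k, Δ^{(k),Lᵏε}(Bᵏ(Λ₂^{(k)}), Ã^{(k+1),ε})Λ₃^{(k)}φ_k⟩"*; p. 560 (2.17)
*"|B(y) − A(x)| ≦ 2Ldp(ε) for x ∈ B(y)"*; p. 557 (2.2) (the small-field conditions, *"|(∂A)(b)| > p(ε)"* negated); I p. 610 (2.23).

THE POINT OF THIS FILE.  Gen 15's trilogy proved (2.108)–(2.109) on the carrier of record for ANY field `B̃` regular on `Ω_k = Bᵏ(Λ₂^{(k−1)′})` in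
r14's LATTICE FORM of (I.2.23): `|B̃_μ(x + εe_ν) − B̃_μ(x)| ≤ δ_A` for EVERY fine `x ∈ Ω_k` and EVERY direction `ν` (+ the coupling smallness
`d²·ε|e|·L^{2k}·δ_A ≤ 1/3`, I p. 611 *"for e(Lᵏε) sufficiently small"*) — HONEST SCOPE (a) there: *"that the actual B̃ of (2.93) is regular is the
printed (2.94)–(2.98), NOT re-derived"*.  Gen 10's `B2Prop31PrintedRestrictions.hreg_of_restricted` derives exactly this form for the §3 field
`Ã^ε` (3.2) = `field32`, but only on the PIECES `Bᵏ(Λ_k)`, `Λ_k = Λ₅^{(k−1)′} ∩ Λ₅^{(k)c}`, where `θ_k = 1` with a one-step margin.  `Ω_k` is larger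
(`Λ₅ ⊂ Λ₂`, (2.8)) and r14's hypothesis reaches one fine step OUTSIDE `Ω_k`, into the slice of `θ_k` (for the constructed `thetaOf`, `θ_k < 1`
there), where the level `k − 1` of (3.2) enters.  THIS FILE closes the gap by print's own mechanism: on the interior `B^{k−1}(Λ₅^{(k−1)})` the
point lies in a piece `Bˡ(Λ_l)`, `l ≥ k` (`exists_piece_of_lamAt`), and gen 10 applies with `δ_l ≤ δ_k`; on the collar `Ω_k ∖ B^{k−1}(Λ₅^{(k−1)})` all
`θ_m`, `m ≥ k + 1`, vanish at `x` and `x + εe_ν`, `θ_{k−1} = 1` at both and `θ_k(x) = 1`, i.e. the pair `(x, x + εe_ν)` carries the `θ_k`-SLICE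
PATTERN ONE LEVEL DOWN, and (2.96)–(2.97) (`field32_regular_slice` at the level pair `(k−1, k)`) apply with Lemma 2.3 for `A^{(k−1),ε}`,
`A^{(k),ε}` AT `x` (§2: gen 13's Lemma-2.3-at-a-point step, exposed on the whole Lemma-2.3 domain `(Λ_{n−1}^{(k−1)})′ ⊇ (Λ₂^{(k−1)})′`, `n ≤ 3`) and
the restriction (2.17) on `A_k(x_k) − A_{k−1}(x_{k−1})` (a `restrictedM` conjunct: `x ∈ B^{k−1}(Λ_{k−1})` and `θ_k(x) ≠ 0`).  For `k = 1` the lower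
configuration is `A₀` and the two inputs are the FIRST-STEP small-field restrictions on `A₀` ((2.2)/(2.16): `|∂A| ≤ p(ε)`; (2.17):
`|B(y) − A(x)| ≤ 2Ldp(ε)`), taken as the hypothesis `Restricted0` in the cell's threshold currency — the only place `A₀` enters.  The modulus
obtained on `Ω_k` is `δ = deltaReg(s_{k−1})`, `s_{k−1} = L^{k−1}ε` (the collar costs one scale: `deltaReg(s_k) ≤ deltaReg(s_{k−1})`), and the
coupling smallness follows from `SmallEpsOmega` (`9d⁴L⁴e²c_A²b₀²·CmS·ε₀^{(4−d)/2} ≤ 1`, gen 10's `SmallEps` with `L⁴` for `Lᵈ`).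

DICTIONARY (print ↦ Lean).  Step `k = l + 1` (`1 ≤ k ≤ K` ↔ `l + 1 ≤ D.K`); `Ω_k = B^{k−1}(Λ₂^{(k−1)})` ↦ `{x : blockIter l x ∈ towerRegion D.bad
(towerRad Q D.P) l 2}` (= gen 15's `t.toInst.Ω`, `mem_Ω_towerStep`; `towerRad Q P l = r(Lˡε)` for `Lˡε ≤ 1`); `B^{k−1}(Λ₅^{(k−1)})` ↦ `D.tower.lamAt l`;
`Ã^ε` (3.2) ↦ `D.toRMultiMRN.field = field32 D.θ D.A₀ D.toRMultiMRN.A D.K` (`θ_m` acting through a bond's initial point, gen 10's READING);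
`A^{(k),ε}` (3.3) ↦ `D.toRMultiMRN.A k = ofSite (cutMin … (zeta244 …) (toSite (D.Ac k)))`; `A_k(y)_μ` ↦ `D.Ac k ⟨y, μ⟩`; `A₀` ↦ `D.A₀`; `θ_k` ↦ `D.θ k`
(DATA with printed properties in `RegionsDataN`; = `thetaOf` for `ofFields` data); the thresholds `thr259/thr260/thr217/deltaReg` of gen 10 at the
DERIVED O(1)'s `l23Consts Γ Q C₁ C₂ = Γ.toConsts (c3Of …) (c5Of …)`; `s_l = D.P.mesh l`.

WHAT IS KERNEL-CHECKED (zero `sorry`, no `def … : Prop` FACT — `Plateau`, `Restricted0`, `SmallEpsOmega` are HYPOTHESES with bodies, `Hyps` a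
`Prop`-valued bundle of the standing inputs; axioms standard).
 §1 `blockIter_succ_mem_prime_iff` (`x_k ∈ Λ′ ↔ x_{k−1} ∈ Λ` for the tower's unions of blocks), **`exists_piece_of_lamAt`** (the pieces cover
    `B^l(Λ₅^{(l)})`), `lam_eq`, `lamAt_iff`, `mem_prev_of_mem_two` (`x_{l+1} ∈ Λ₂^{(l+1)} ⇒ x_l ∈ Λ_i^{(l)}`, `i ≤ 7`), **`theta_eq_zero_of_not_lamAt`**
    (off `Bˡ(Λ₅^{(l)})` every `θ_m`, `m ≥ l + 2`, vanishes at `x` and `x + εe_ν`).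
 §2 `l23Consts`, `l23Consts_valid`, **`lemma23_at`** (Lemma 2.3 (2.59)/(2.60) for `A^{(k),ε}` at every `x` with `x_k` in the Lemma-2.3 domain).
 §3 `Plateau`, `Restricted0`, `deltaReg_anti`, `field32_eq_level0` ((3.2) with only the levels 0, 1 alive), `Hyps` (+ `valid`, `two_le_d`, `lemma23`),
    **`regular_interior`** (`δ_k` on `B^{k−1}(Λ₅^{(k−1)})`), **`regular_collar_succ`** (`δ_{k−1}` on the collar, `k ≥ 2`), **`regular_collar_zero`**
    (`δ₀` on `Λ₂^{(0)} ∖ Λ₅^{(0)}`), **`field_regular_omega`** (THE REGULARITY ON ALL OF `Ω_k`: `|Ã^ε_μ(x + εe_ν) − Ã^ε_μ(x)| ≤ deltaReg(s_{k−1})`).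
 §4 `SmallEpsOmega`, **`small_omega`** (`d²(ε|e|)(Lℓ)²deltaReg(s) ≤ 1/3`), **`towerStep`** (the datum's (2.108) step as a `TowerData`: field
    `:= Ã^ε`, `δ_A := deltaReg(s_l)`, the datum's `bad`/radii), `towerStep_A/_dA`, `mem_Ω_towerStep`, **`reg_towerStep : TowerData.Reg a (towerStep …)`**.
 §5 `towerIdxOfData : TowerIdx Q.d Q.L Q.a` (the datum's step is a member of the family of `ineq2109_tower`/`ineq38_tower`/`norm_Hk_le_tower`),
    **`abs_hk_le_ofData`** ((2.109)₁ = (3.8) pointwise for the step's `H_k`, no field hypothesis), **`hkUnit_le_pow_ofData`** ((2.109)₂, printed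
    radii/ranges), **`abs_form_hk_le_ofData`** (the (2.108) error term), **`plateau_ofFields`** (gen 13's `ofFields` data satisfy `Plateau`).
 §6 (v1.1) NON-VACUITY: `constData` (gen 13's `ofFields` datum with `A₀ ≡ A_k ≡ v`, `Φ = 0`), `constData_restrictedM`, `constData_plateau`,
    `constData_restricted0`, **`constData_field_ne_zero`**, `constData_hyps`, **`exists_hyps_restricted0_field_ne_zero`** (for `R ≥ R₁`, `Lᴷε ≤ s₁`,
    small `v ≠ 0`, every torus / `K` / large-field configuration: `Hyps ∧ Restricted0 ∧ Ã^ε ≠ 0` jointly).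

HONEST SCOPE.  (a) INPUTS that remain: the printed free data of `RegionsDataN` (torus of the sub-family, steps, large-field points, charge, `A₀`,
block fields `A_k`, `Φ`, cut-offs with their p. 567 properties — constructed as `thetaOf` in `ofFields`), the (2.55)-type restrictions
`restrictedM` on the block fields (print's hypothesis of Lemma 2.3 / Prop. 3.1), r14's Lemma 2.3 package and the enlarged (2.7) largeness
`R ≥ (L/n)(2/δ + 2M + 2)` (gen 13), `d ∈ {2, 3}` via `2 ≤ d ≤ 3`, the coupling smallness `SmallEpsOmega` (explicit O(1) condition on `e·ε₀^{(4−d)/4}`),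
and — ONLY for `k = 1` — `Restricted0` (first-step (2.2)/(2.17) restrictions on `A₀` at the collar `Λ₂^{(0)} ∖ Λ₅^{(0)}`; `A₀` is met solely because
r14's one-step hypothesis crosses `∂Λ₂^{(0)}`; print's (I.2.23) is a statement on `Ω`).  (b) The field is the §3 `Ã^ε` (3.2) — on `Ω_k` it equals
`Ã^{(k),ε}` (3.4) (gen 10 `field32_eq_field34`), the field printed in (3.5); the §2 two-scale `B̃ = (1 − θ_{k+1})A^{(k)} + θ_{k+1}B^{(k+1),η}` of (2.108)
is its instance with the steps above `k + 1` absent (same mechanism; not separately packaged).  (c) The modulus is `deltaReg(s_{k−1})`, one scale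
coarser than gen 10's `deltaReg(s_k)` on the pieces (the collar is a `θ_k`-slice); constants explicit and crude.  (d) `n ≤ 3` suffices for §3–§4
given `Plateau` (Lemma 2.3 is used at `x ∈ Ω_k` only, never at the shifted point); `Plateau` is discharged for `ofFields` (`n ≤ 2`).  (e) Non-vacuity
(§6, v1.1): `Hyps ∧ Restricted0 ∧ Ã^ε ≠ 0` jointly, by gen 13's `B2Eq245ThetaNonzero` pattern with `A₀ ≡ v` (constant tower — the physically
trivial instance; a non-constant multi-step instance is not attempted); `SmallEpsOmega` is a condition on `e·ε₀^{(4−d)/4}` alone and is left as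
print's «e sufficiently small».  (f) Cells only; NOT summit progress.
-/

noncomputable section

open Finset

namespace Literature.MathematicalPhysics.QuantumFieldTheory.Balaban1983to89.B2Eq298RegularOmega

open Literature.MathematicalPhysics.QuantumFieldTheory.Balaban1983to89.HiggsLattice
open Literature.MathematicalPhysics.QuantumFieldTheory.Balaban1983to89.HiggsAveraging
open Literature.MathematicalPhysics.QuantumFieldTheory.Balaban1983to89.B2Eq337ScalarIntegration
open Literature.MathematicalPhysics.QuantumFieldTheory.Balaban1983to89.B2Eq328ConcretePieces
open Literature.MathematicalPhysics.QuantumFieldTheory.Balaban1983to89.B2Eq324NestedRegions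
open Literature.MathematicalPhysics.QuantumFieldTheory.Balaban1983to89.B2Eq32FieldRegularity
open Literature.MathematicalPhysics.QuantumFieldTheory.Balaban1983to89.B2Prop31Thresholds
open Literature.MathematicalPhysics.QuantumFieldTheory.Balaban1983to89.B2Prop31PrintedRestrictions
open Literature.MathematicalPhysics.QuantumFieldTheory.Balaban1983to89.B2Prop31ZeroFieldConcrete (mesh_le_mesh)
open Literature.MathematicalPhysics.QuantumFieldTheory.Balaban1983to89.B3MultiscaleFields (toSite ofSite zeroCharge toSite_ofSite)
open Literature.MathematicalPhysics.QuantumFieldTheory.Balaban1983to89.B2Lemma23HiggsLattice (cutMin)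
open Literature.MathematicalPhysics.QuantumFieldTheory.Balaban1983to89.B1Eq211ZeroFieldTorus (Shape)
open Literature.MathematicalPhysics.QuantumFieldTheory.Balaban1983to89.B2Prop31MinimizerFamily (MinConsts Lemma23Bounds)
open Literature.MathematicalPhysics.QuantumFieldTheory.Balaban1983to89.B2Prop31MinimizerRegions
  (lemma23_thresholds_rad towerRad towerRad_eq le_towerRad towerRad_nonneg)
open Literature.MathematicalPhysics.QuantumFieldTheory.Balaban1983to89.B2Prop31MinimizerRegionsN
open Literature.MathematicalPhysics.QuantumFieldTheory.Balaban1983to89.B2Eq243RegionsTower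
  (towerRegion towerOf towerOf_lam_of_lt towerRegion_antitone towerRegion_blockOf_congr mem_seven_of_blockOf_mem_succ)
open Literature.MathematicalPhysics.QuantumFieldTheory.Balaban1983to89.B2Ineq2109HiggsLattice (Inst Adm gam c227 c229)
open Literature.MathematicalPhysics.QuantumFieldTheory.Balaban1983to89.B2Ineq2109HiggsLatticeTower (TowerData TowerIdx)
open Literature.MathematicalPhysics.QuantumFieldTheory.Balaban1983to89.B2Eq245Theta (thetaOf thetaOf_eq_one_of_mem mem_plateau)
open B2Sect2BDensities (Nested)

variable {P : HiggsLattice.Params}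

/-! ## §1 Geometry of `Ω_k = Bᵏ(Λ₂^{(k−1)′})` on the constructed tower -/

/-- `x ∈ Bᵏ(Λ′) ↔ x ∈ B^{k−1}(Λ)` for a union `Λ = Λ_i^{(k−1)}` of blocks of `T^{(k−1)}` ((I.1.16): `Λ′ = Λ ∩ T^{(k)}`; the tower's
regions are unions of big blocks): in block labels, `x_k ∈ (Λ_i^{(j)})′ ↔ x_j ∈ Λ_i^{(j)}`, `k = j + 1`.
[cite: Balaban1982Higgs1, (1.16)–(1.20) pp.606–607] [cite: Balaban1982Higgs2, (2.43) p.566] -/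
theorem blockIter_succ_mem_prime_iff {bad : (j : ℕ) → Set (HiggsLattice.Site P j)} {r : ℕ → ℝ} (j i : ℕ)
    (z : HiggsLattice.Site P 0) :
    blockIter (j + 1) z ∈ prime (towerRegion bad r j i) ↔ blockIter j z ∈ towerRegion bad r j i := by
  rw [mem_prime]
  constructor
  · intro h
    exact h (blockIter j z) rfl
  · intro h x hx
    exact (towerRegion_blockOf_congr j i (x := x) (x' := blockIter j z) hx).mpr h

/-- **The pieces cover the small-field region**: if `x_l ∈ Λ₅^{(l)}` (`l ≤ K`; `Λ₅^{(K)} = ∅`) then `x ∈ Bʲ⁺¹(Λ_{j+1})`,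
`Λ_{j+1} = Λ₅^{(j)′} ∩ Λ₅^{(j+1)c}`, for some `l ≤ j < K` (the first level at which `x` leaves the tower).
[cite: Balaban1982Higgs2, (3.22)–(3.24) p.588] -/
theorem exists_piece_of_lamAt {K : ℕ} (T : Tower P K) :
    ∀ (m l : ℕ), l + m = K → ∀ z : HiggsLattice.Site P 0, T.lamAt l z → ∃ j : Fin K, l ≤ j.val ∧ z ∈ pieceF T.regions j
  | 0, l, h, z, hz => by
    have hl : l = K := by omega
    subst hl
    exact absurd hz (T.not_lamAt_top z)
  | m + 1, l, h, z, hz => by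
    by_cases h1 : T.lamAt (l + 1) z
    · obtain ⟨j, hj, hjz⟩ := exists_piece_of_lamAt T m (l + 1) (by omega) z h1
      exact ⟨j, by omega, hjz⟩
    · refine ⟨⟨l, by omega⟩, le_rfl, ?_⟩
      rw [mem_pieceF, T.inPiece_regions_iff]
      exact ⟨hz, h1⟩

section Data

variable {n : ℕ} {Q : B2.Params} {Γ : MinConsts} {M : ℕ} {m2 : ℝ}

/-- The regions of the datum's tower below `K` are the constructed `Λ₅^{(l)}`. [cite: Balaban1982Higgs2, (3.22) p.588] -/
theorem lam_eq (D : RegionsDataN n Q Γ M m2) {l : ℕ} (hl : l < D.K) :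
    D.tower.lam l = towerRegion D.bad (towerRad Q D.P) l 5 :=
  towerOf_lam_of_lt (bad := D.bad) (hr := towerRad_nonneg D.hR0 D.hr0 D.P) hl

/-- `x ∈ Bˡ(Λ₅^{(l)})` in the datum's tower iff `x_l ∈ Λ₅^{(l)}` (`l < K`). [cite: Balaban1982Higgs2, (3.22)–(3.23) p.588] -/
theorem lamAt_iff (D : RegionsDataN n Q Γ M m2) {l : ℕ} (hl : l < D.K) (z : HiggsLattice.Site D.P 0) :
    D.tower.lamAt l z ↔ blockIter l z ∈ towerRegion D.bad (towerRad Q D.P) l 5 := by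
  show blockIter l z ∈ D.tower.lam l ↔ _
  rw [lam_eq D hl]

/-- Cross-level: `x_{l+1} ∈ Λ₂^{(l+1)}` ⇒ `x_l ∈ Λ_i^{(l)}` for every `i ≤ 7` (p. 566 *"Λ₀^{(j+1)} ⊂ Λ₇^{(j)′}"*).
[cite: Balaban1982Higgs2, (2.43) p.566, (3.22) p.588] -/
theorem mem_prev_of_mem_two (D : RegionsDataN n Q Γ M m2) {l : ℕ} {z : HiggsLattice.Site D.P 0}
    (h : blockIter (l + 1) z ∈ towerRegion D.bad (towerRad Q D.P) (l + 1) 2) {i : ℕ} (hi : i ≤ 7) :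
    blockIter l z ∈ towerRegion D.bad (towerRad Q D.P) l i :=
  towerRegion_antitone (towerRad_nonneg D.hR0 D.hr0 D.P l) hi
    (mem_seven_of_blockOf_mem_succ (towerRad_nonneg D.hR0 D.hr0 D.P (l + 1)) h)

/-- **The cut-offs above the collar vanish**: if `x ∉ Bˡ(Λ₅^{(l)})` then `θ_m(x) = θ_m(x + εe_ν) = 0` for every `m ≥ l + 2` (the support
of `θ_m` and its one-step neighbourhood lie over `Λ₅^{(m−2)} ⊆ …`; `θ_m = 0` above `K`). [cite: Balaban1982Higgs2, p.567, (3.2) p.583] -/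
theorem theta_eq_zero_of_not_lamAt (D : RegionsDataN n Q Γ M m2) {l : ℕ} {z : HiggsLattice.Site D.P 0}
    (hz : ¬ D.tower.lamAt l z) {m : ℕ} (hm : l + 2 ≤ m) (ν : Fin D.P.d) :
    D.θ m z = 0 ∧ D.θ m (z.shift ν) = 0 := by
  by_cases hmK : m ≤ D.K
  · obtain ⟨l', rfl⟩ : ∃ l', m = l' + 2 := ⟨m - 2, by omega⟩
    have key : ∀ {w : Prop}, (¬ w → D.θ (l' + 2) z ≠ 0 ∨ ∃ ν, D.θ (l' + 2) (z.shift ν) ≠ 0) → w := by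
      intro w hw
      by_contra hc
      exact hz (D.tower.lamAt_anti (show l ≤ l' by omega) (by omega) z (D.θ_zero l' hmK z (hw hc)))
    exact ⟨key fun hc => Or.inl hc, key fun hc => Or.inr ⟨ν, hc⟩⟩
  · exact ⟨D.θ_above m (by omega) z, D.θ_above m (by omega) (z.shift ν)⟩

end Data

/-! ## §2 Lemma 2.3 (2.59)/(2.60) for the (3.3) minimizers at a point over the Lemma-2.3 domain `(Λ_{n−1}^{(k−1)})′` -/

section Lemma23

variable {n : ℕ} {Q : B2.Params} {Γ : MinConsts} {M : ℕ} {m2 : ℝ}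

/-- The cell's thresholds record with the Lemma-2.3-DERIVED O(1)'s `c₃ = c3Of`, `c₅ = c5Of` (gen 11/13). [cite: Balaban1982Higgs2, Lemma 2.3 (2.59)–(2.60) p.571] -/
def l23Consts (Γ : MinConsts) (Q : B2.Params) (C₁ C₂ : ℝ) : B2Prop31Thresholds.Consts :=
  Γ.toConsts (Γ.c3Of Q.a Q.L C₁ C₂) (Γ.c5Of C₁ C₂)

/-- The derived record is valid (`a > 0`, `L > 1`, `C₁, C₂ ≥ 0`). [cite: Balaban1982Higgs2, Lemma 2.3 p.571] -/
theorem l23Consts_valid (hΓ : Γ.Valid) (hQa : 0 < Q.a) (hQL : 1 < Q.L) {C₁ C₂ : ℝ} (hC₁ : 0 ≤ C₁) (hC₂ : 0 ≤ C₂) :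
    (l23Consts Γ Q C₁ C₂).Valid :=
  MinConsts.toConsts_valid hΓ (MinConsts.c3Of_nonneg hΓ hQa hQL hC₁ hC₂) (MinConsts.c5Of_nonneg hΓ hC₁ hC₂)

/-- **LEMMA 2.3 AT A POINT `x ∈ Bᵏ(Λ₂-region of level k)` FOR THE INSTANCE'S MINIMIZER `A^{(k),ε}`** (`1 ≤ k ≤ K`): (2.59)
`|A^{(k),ε}(⟨x,μ⟩) − A_k(x_k)_μ| ≤ thr259(s_k)` and (2.60) `|A^{(k),ε}(⟨x+εe_ν,μ⟩) − A^{(k),ε}(⟨x,μ⟩)| ≤ thr260(s_k)` from the printed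
restrictions `restrictedM`, r14's Lemma 2.3 on the carrier (`Lemma23Bounds`) and the enlarged largeness `R ≥ (L/n)(2/δ + 2M + 2)` of (2.7)
— verbatim the `key` step of gen 13's `RMultiMRN.restricted_toRMultiP`, exposed at every point of the Lemma-2.3 domain (not only on the pieces).
[cite: Balaban1982Higgs2, Lemma 2.3 (2.59)–(2.60) p.571, (3.3) p.583, (2.7) p.558] -/
theorem lemma23_at (hn : 1 ≤ n) (hΓ : Γ.Valid) (hQa : 0 < Q.a) {δ C₁ C₂ : ℝ}
    (pkg : Lemma23Bounds Q.d Q.L Q.a Γ.μ0sq Γ.ε₀ δ C₁ C₂) (hδ : 0 < δ) (hC₂ : 0 ≤ C₂)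
    (hR : (Q.L : ℝ) / n * (2 / δ + 2 * (M : ℝ) + 2) ≤ Q.R) (hr : 1 ≤ Q.r) (i : RMultiMRN n Q Γ M m2) (hrM : i.restrictedM)
    {k : ℕ} (hk1 : 1 ≤ k) (hk : k ≤ i.K) (x : HiggsLattice.Site i.P 0) (hx : blockIter k x ∈ i.L2 k) (μ ν : Fin i.P.d) :
    |i.A k ⟨x, μ⟩ - i.Ac k ⟨blockIter k x, μ⟩| ≤ thr259 (l23Consts Γ Q C₁ C₂) i.P.d (i.P.mesh k)
    ∧ |i.A k ⟨x.shift ν, μ⟩ - i.A k ⟨x, μ⟩| ≤ thr260 (l23Consts Γ Q C₁ C₂) i.P.d i.P.ε (i.P.mesh k) := by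
  obtain ⟨hsup, hvar, -, -⟩ := hrM
  have hR' : (i.P.L : ℝ) / n * (2 / δ + 2 * (i.P.M : ℝ) + 2) ≤ Q.R := by rw [i.hL, i.hM]; exact hR
  have hm := i.mesh_le_eps0 hΓ hk
  have hE : Real.exp (-(δ * (radN n Q.R Q.r i.P k / 2))) ≤ i.P.mesh k := exp_neg_delta_radN_le hn hk1 hm.2 hδ hR' hr
  have hρ0 : 0 ≤ radN n Q.R Q.r i.P k := by
    have h := radN_ge_mul_u hn hk1 hm.2 (by positivity : (0 : ℝ) ≤ 2 / δ) hR' hr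
    have hu : 1 ≤ 1 + Real.log (i.P.mesh k)⁻¹ := one_le_u (i.P.mesh_pos k) hm.2
    have : 0 ≤ 2 / δ * (1 + Real.log (i.P.mesh k)⁻¹) := by positivity
    linarith
  exact lemma23_thresholds_rad hΓ hQa pkg hC₂ i.S i.hd i.hL hk1 (hk.trans i.hK) hm.2 hm.1 hρ0 hE (i.ζ k) (i.ζ_abs k hk1 hk)
    (i.ζ_supp k hk1 hk) (i.ζ_one k hk1 hk) (i.ζ_lip k hk1 hk) (i.L1 k) (i.L2 k) (i.L2_sub k) (i.nbhd k hk1 hk) (i.Ac k)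
    (hsup k hk1 hk) (hvar k hk1 hk) x hx μ ν

end Lemma23

/-! ## §3 The regularity of `Ã^ε` on `Ω_k = Bᵏ(Λ₂^{(k−1)′})`: interior by the pieces, collar by (2.96)–(2.97) one level down -/

section Regular

variable {n : ℕ} {Q : B2.Params} {Γ : MinConsts} {M : ℕ} {m2 : ℝ}

/-- **`θ_k = 1` on `B^{k−1}(Λ₂^{(k−1)})`** (p. 567 *"The function θ_k … is equal to 1 on B^{k−1}(Λ₂^{(k−1)})"*) for the datum's cut-offs relative
to ITS tower (`k = l + 1 ≤ K`): the one printed property of `θ_k` that `RegionsDataN` does not record (its `θ_one` is the weaker `θ_k = 1` over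
`Λ₅^{(k−1)} ⊂ Λ₂^{(k−1)}`); it holds for the constructed `thetaOf` (`plateau_ofFields`, §5). [cite: Balaban1982Higgs2, p.567, (2.45) p.567] -/
def Plateau (D : RegionsDataN n Q Γ M m2) : Prop :=
  ∀ l, l + 1 ≤ D.K → ∀ z : HiggsLattice.Site D.P 0, blockIter l z ∈ towerRegion D.bad (towerRad Q D.P) l 2 → D.θ (l + 1) z = 1

/-- **The first-step small-field restrictions on `A₀` at the collar `Λ₂^{(0)} ∖ Λ₅^{(0)}`** (used ONLY for `k = 1`, where r14's one-fine-step
form of (I.2.23) reaches across `∂Λ₂^{(0)}` into the `θ₁`-slice, so that `(1 − θ₁)A₀` of (3.2) enters): (2.2)/(2.16) *"|(∂A)(b)| ≤ p(ε)"* and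
(2.17) *"|B(y) − A(x)| ≦ 2Ldp(ε) for x ∈ B(y)"* (A = the fine field `A₀`, B = the first block field `A₁`), in physical units with the cell's
O(1)'s (`thr260`, `thr217` at the scale `s₀ = ε`). [cite: Balaban1982Higgs2, (2.2) p.557, (2.16)–(2.17) pp.559–560, (3.2) p.583] -/
def Restricted0 (D : RegionsDataN n Q Γ M m2) (Γc : B2Prop31Thresholds.Consts) : Prop :=
  ∀ z : HiggsLattice.Site D.P 0, z ∈ towerRegion D.bad (towerRad Q D.P) 0 2 → z ∉ towerRegion D.bad (towerRad Q D.P) 0 5 →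
    ∀ μ ν : Fin D.P.d, |D.A₀ ⟨z.shift ν, μ⟩ - D.A₀ ⟨z, μ⟩| ≤ thr260 Γc D.P.d D.P.ε (D.P.mesh 0)
      ∧ |D.Ac 1 ⟨blockIter 1 z, μ⟩ - D.A₀ ⟨z, μ⟩| ≤ thr217 Γc D.P.d (D.P.mesh 0)

/-- `deltaReg` is antitone in the scale on `(0, 1]` (as `thr260`; `c_A ≥ 0`). [cite: Balaban1982Higgs2, (2.98) p.577] -/
theorem deltaReg_anti {Γc : B2Prop31Thresholds.Consts} (h : Γc.Valid) (d : ℕ) {ε s t : ℝ} (hε : 0 ≤ ε) (hs : 0 < s) (hst : s ≤ t)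
    (ht : t ≤ 1) : deltaReg Γc d ε t ≤ deltaReg Γc d ε s := by
  unfold deltaReg
  have hexp : -(d : ℝ) / 2 ≤ 0 := by
    have : (0 : ℝ) ≤ d := Nat.cast_nonneg _
    linarith
  have h1 : t ^ (-(d : ℝ) / 2) ≤ s ^ (-(d : ℝ) / 2) := Real.rpow_le_rpow_of_nonpos hs hst hexp
  have h2 : B2.pFn Γc.b₀ Γc.p t ≤ B2.pFn Γc.b₀ Γc.p s := B1Ineq352Proof.pFn_anti h.b₀_nonneg h.p_pos.le hs hst ht
  have hp0 : 0 ≤ B2.pFn Γc.b₀ Γc.p t := pFn_nonneg' h (hs.trans_le hst) ht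
  have hc : 0 ≤ Γc.cA * ε := mul_nonneg (Consts.cA_nonneg h) hε
  calc Γc.cA * ε * t ^ (-(d : ℝ) / 2) * B2.pFn Γc.b₀ Γc.p t
      ≤ Γc.cA * ε * s ^ (-(d : ℝ) / 2) * B2.pFn Γc.b₀ Γc.p t :=
        mul_le_mul_of_nonneg_right (mul_le_mul_of_nonneg_left h1 hc) hp0
    _ ≤ Γc.cA * ε * s ^ (-(d : ℝ) / 2) * B2.pFn Γc.b₀ Γc.p s :=
        mul_le_mul_of_nonneg_left h2 (mul_nonneg hc (Real.rpow_nonneg hs.le _))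

/-- **(3.2) with only the levels `0`, `1` alive**: where `θ_m(b₋) = 0` for every `m ≥ 2`, `Ã^ε(b) = (1 − θ₁(b₋))A₀(b) + θ₁(b₋)A^{(1),ε}(b)`
(`K ≥ 1`). [cite: Balaban1982Higgs2, (3.2) p.583, (2.51) p.569] -/
theorem field32_eq_level0 (θ : ℕ → HiggsLattice.Site P 0 → ℝ) (A₀ : HiggsLattice.VecField P 0) (A : ℕ → HiggsLattice.VecField P 0)
    {K : ℕ} (hK : 1 ≤ K) (x : HiggsLattice.Site P 0) (μ : Fin P.d) (h0 : ∀ m, 2 ≤ m → θ m x = 0) :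
    field32 θ A₀ A K ⟨x, μ⟩ = (1 - θ 1 x) * A₀ ⟨x, μ⟩ + θ 1 x * A 1 ⟨x, μ⟩ := by
  rw [field32_apply]
  dsimp only
  by_cases hK1 : K = 1
  · subst hK1
    simp
  · have hK2 : 2 ≤ K := by omega
    rw [Finset.sum_eq_single_of_mem 1 (Finset.mem_Ico.mpr ⟨le_rfl, by omega⟩)]
    · rw [h0 2 le_rfl, h0 K hK2]
      ring
    · intro l hl hl1
      rw [Finset.mem_Ico] at hl
      rw [h0 l (by omega)]
      ring

/-- **THE STANDING INPUTS** of the derivation, for a datum `D` and Lemma-2.3 constants `(δ, C₁, C₂)`: valid O(1)'s, `a > 0`, `d ≥ 2`,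
r14's Lemma 2.3 on the carrier in gen 11's packaged form (`Lemma23Bounds`, inhabited: `exists_lemma23Bounds`), the enlarged largeness
`R ≥ (L/n)(2/δ + 2M + 2)` of (2.7) (*"R has to be > R₀"*), the printed (2.55)-type restrictions `restrictedM` on the block fields, and the
plateau property of the cut-offs (p. 567). [cite: Balaban1982Higgs2, (2.7) p.558, (2.55) p.570, Lemma 2.3 p.571, p.567] -/
structure Hyps (D : RegionsDataN n Q Γ M m2) (δ C₁ C₂ : ℝ) : Prop where
  hΓ : Γ.Valid
  ha : 0 < Q.a
  hd2 : 2 ≤ Q.d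
  pkg : Lemma23Bounds Q.d Q.L Q.a Γ.μ0sq Γ.ε₀ δ C₁ C₂
  hδ : 0 < δ
  hC₁ : 0 ≤ C₁
  hC₂ : 0 ≤ C₂
  hR : (Q.L : ℝ) / n * (2 / δ + 2 * (M : ℝ) + 2) ≤ Q.R
  restricted : D.toRMultiMRN.restrictedM
  plateau : Plateau D

variable {D : RegionsDataN n Q Γ M m2} {δ C₁ C₂ : ℝ}

/-- validity of the derived thresholds record for the datum's parameters. [cite: Balaban1982Higgs2, Lemma 2.3 p.571] -/
theorem Hyps.valid (H : Hyps D δ C₁ C₂) : (l23Consts Γ Q C₁ C₂).Valid :=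
  l23Consts_valid H.hΓ H.ha (by rw [← D.hL]; exact D.S.hL.2) H.hC₁ H.hC₂

/-- `d ≥ 2` on the datum's torus. [cite: Balaban1982Higgs2, p.557] -/
theorem Hyps.two_le_d (H : Hyps D δ C₁ C₂) : 2 ≤ D.P.d := by rw [D.hd]; exact H.hd2

/-- Lemma 2.3 at a point, for the datum (§2 specialised). [cite: Balaban1982Higgs2, Lemma 2.3 (2.59)–(2.60) p.571] -/
theorem Hyps.lemma23 (H : Hyps D δ C₁ C₂) {k : ℕ} (hk1 : 1 ≤ k) (hk : k ≤ D.K) (x : HiggsLattice.Site D.P 0)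
    (hx : blockIter k x ∈ D.toRMultiMRN.L2 k) (μ ν : Fin D.P.d) :
    |D.toRMultiMRN.A k ⟨x, μ⟩ - D.Ac k ⟨blockIter k x, μ⟩| ≤ thr259 (l23Consts Γ Q C₁ C₂) D.P.d (D.P.mesh k)
    ∧ |D.toRMultiMRN.A k ⟨x.shift ν, μ⟩ - D.toRMultiMRN.A k ⟨x, μ⟩| ≤ thr260 (l23Consts Γ Q C₁ C₂) D.P.d D.P.ε (D.P.mesh k) :=
  lemma23_at D.hn1 H.hΓ H.ha H.pkg H.hδ H.hC₂ H.hR D.hr D.toRMultiMRN H.restricted hk1 hk x hx μ ν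

/-- **THE INTERIOR `B^{k−1}(Λ₅^{(k−1)})` OF `Ω_k`**: there `x` lies in a piece `Bʲ⁺¹(Λ_{j+1})` with `j + 1 ≥ k`, on which gen 10's
`hreg_of_restricted` (fed by gen 13's `restricted_toRMultiP`) bounds the difference by `δ_{j+1} ≤ δ_k` (`deltaReg` antitone).
[cite: Balaban1982Higgs2, (2.98) p.577, (3.22)–(3.24) p.588] -/
theorem regular_interior (H : Hyps D δ C₁ C₂) (l : ℕ) (hl : l + 1 ≤ D.K) (z : HiggsLattice.Site D.P 0) (hz : D.tower.lamAt l z)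
    (μ ν : Fin D.P.d) :
    |D.toRMultiMRN.field ⟨z.shift ν, μ⟩ - D.toRMultiMRN.field ⟨z, μ⟩|
      ≤ deltaReg (l23Consts Γ Q C₁ C₂) D.P.d D.P.ε (D.P.mesh (l + 1)) := by
  have hΓc := H.valid
  obtain ⟨j, hlj, hjz⟩ := exists_piece_of_lamAt D.tower (D.K - l) l (by omega) z hz
  have hres : (D.toRMultiMRN.toRMultiP (Γ.c3Of Q.a Q.L C₁ C₂) (Γ.c5Of C₁ C₂)).restricted :=
    RMultiMRN.restricted_toRMultiP D.hn1 H.hΓ H.ha H.pkg H.hδ H.hC₂ H.hR D.hr _ H.restricted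
  have h := hreg_of_restricted hΓc (D.toRMultiMRN.toRMultiP (Γ.c3Of Q.a Q.L C₁ C₂) (Γ.c5Of C₁ C₂)) H.two_le_d hres j z hjz μ ν
  refine h.trans (deltaReg_anti hΓc D.P.d D.P.hε.le (D.P.mesh_pos _) (mesh_le_mesh (by omega)) ?_)
  exact D.mesh_le_one (Nat.succ_le_of_lt j.isLt)

/-- **THE COLLAR `Ω_k ∖ B^{k−1}(Λ₅^{(k−1)})`, `k = l + 2 ≥ 2`**: at such `x` (`x_{l+1} ∈ Λ₂^{(l+1)} ∖ Λ₅^{(l+1)}`) the cut-offs `θ_m`,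
`m ≥ l + 3`, vanish at `x` and `x + εe_ν`, `θ_{l+1} = 1` at both (`x_l ∈ Λ₇^{(l)} ⊂ Λ₅^{(l)}`), `θ_{l+2}(x) = 1` and `0 ≤ θ_{l+2}(x + εe_ν) ≤ 1`
with `|θ_{l+2}(x + εe_ν) − θ_{l+2}(x)| ≤ c_θL^{−(l+1)}` — the `θ_{l+2}`-slice pattern one level DOWN — so (2.96)–(2.97) (gen 10's
`field32_regular_slice` at the level pair `(l+1, l+2)`) with Lemma 2.3 for `A^{(l+1),ε}`, `A^{(l+2),ε}` at `x` (§2; `x_{l+2} ∈ (Λ₂^{(l+1)})′`,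
`x_{l+1} ∈ (Λ₇^{(l)})′`) and the restriction (2.17) on `A_{l+2}(x_{l+2}) − A_{l+1}(x_{l+1})` give the bound `δ_{l+1}`.
[cite: Balaban1982Higgs2, (2.96)–(2.98) pp.576–577, Lemma 2.3 p.571, (2.17) p.560, p.567] -/
theorem regular_collar_succ (H : Hyps D δ C₁ C₂) (l : ℕ) (hl : l + 2 ≤ D.K) (z : HiggsLattice.Site D.P 0)
    (hz2 : blockIter (l + 1) z ∈ towerRegion D.bad (towerRad Q D.P) (l + 1) 2)
    (hz5 : blockIter (l + 1) z ∉ towerRegion D.bad (towerRad Q D.P) (l + 1) 5) (μ ν : Fin D.P.d) :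
    |D.toRMultiMRN.field ⟨z.shift ν, μ⟩ - D.toRMultiMRN.field ⟨z, μ⟩|
      ≤ deltaReg (l23Consts Γ Q C₁ C₂) D.P.d D.P.ε (D.P.mesh (l + 1)) := by
  have hΓc := H.valid
  have hΓ := H.hΓ
  have hr0 : ∀ j, 0 ≤ towerRad Q D.P j := towerRad_nonneg D.hR0 D.hr0 D.P
  have hn3 := D.hn3
  -- geometry
  have h5 : blockIter l z ∈ towerRegion D.bad (towerRad Q D.P) l 5 := mem_prev_of_mem_two D hz2 (by norm_num)
  have hn1 : blockIter l z ∈ towerRegion D.bad (towerRad Q D.P) l (n - 1) := mem_prev_of_mem_two D hz2 (by omega)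
  have hlam : D.tower.lamAt l z := (lamAt_iff D (by omega) z).mpr h5
  have hnot : ¬ D.tower.lamAt (l + 1) z := fun h => hz5 ((lamAt_iff D (by omega) z).mp h)
  have hpiece : z ∈ pieceF D.tower.regions ⟨l, by omega⟩ := by
    rw [mem_pieceF, D.tower.inPiece_regions_iff]
    exact ⟨hlam, hnot⟩
  -- the cut-offs
  obtain ⟨h1, h1s⟩ := D.θ_one (l + 1) (by omega) (by omega) z
    (by show D.tower.lamAt (l + 1 - 1) z; rw [Nat.add_sub_cancel]; exact hlam)
  obtain ⟨h0, h0'⟩ := theta_eq_zero_of_not_lamAt D hnot (m := l + 1 + 2) (by omega) ν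
  have hpl : D.θ (l + 2) z = 1 := H.plateau (l + 1) hl z hz2
  -- Lemma 2.3 at the levels `l + 1`, `l + 2` at `z`
  have hx1 : blockIter (l + 1) z ∈ D.toRMultiMRN.L2 (l + 1) := by
    rw [RegionsDataN.toRMultiMRN_L2_succ]
    exact (blockIter_succ_mem_prime_iff l (n - 1) z).mpr hn1
  have hx2 : blockIter (l + 2) z ∈ D.toRMultiMRN.L2 (l + 2) := by
    rw [RegionsDataN.toRMultiMRN_L2_succ]
    exact (blockIter_succ_mem_prime_iff (l + 1) (n - 1) z).mpr (towerRegion_antitone (hr0 _) (by omega) hz2)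
  obtain ⟨h59a, h60a⟩ := H.lemma23 (k := l + 1) (by omega) (by omega) z hx1 μ ν
  obtain ⟨h59b, h60b⟩ := H.lemma23 (k := l + 2) (by omega) hl z hx2 μ ν
  -- the restriction (2.17) on the slice
  obtain ⟨-, -, h217, -⟩ := H.restricted
  have h217z : |D.Ac (l + 2) ⟨blockIter (l + 2) z, μ⟩ - D.Ac (l + 1) ⟨blockIter (l + 1) z, μ⟩|
      ≤ Γ.thr217M D.P.d (D.P.mesh (l + 1)) :=
    h217 ⟨l, by show l < D.K; omega⟩ z hpiece μ ν (Or.inl (by show D.θ (l + 2) z ≠ 0; rw [hpl]; exact one_ne_zero))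
  -- scales
  have hs12 : D.P.mesh (l + 1) ≤ D.P.mesh (l + 2) := mesh_le_mesh (by omega)
  have hs2 : D.P.mesh (l + 2) ≤ 1 := D.mesh_le_one hl
  have hd2' := H.two_le_d
  have hmpos := D.P.mesh_pos (l + 1)
  have hs1 : D.P.mesh (l + 1) ≤ 1 := hs12.trans hs2
  have hLpos : (0 : ℝ) < D.P.L := by exact_mod_cast D.P.hL
  -- (2.96)–(2.97) at the level pair (l+1, l+2)
  have hmain := field32_regular_slice D.θ D.A₀ D.toRMultiMRN.A D.θ_nested (k := l + 1) (K := D.K) (by omega) hl z μ ν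
    h1 h0 (h1s ν) h0' (D.θ_range _ _).1 (D.θ_range _ _).2
    (ϑ := Γ.cθ * ((D.P.L : ℝ) ^ (l + 1))⁻¹)
    (α := thr259 (l23Consts Γ Q C₁ C₂) D.P.d (D.P.mesh (l + 1)))
    (α' := thr259 (l23Consts Γ Q C₁ C₂) D.P.d (D.P.mesh (l + 1)))
    (β := Γ.thr217M D.P.d (D.P.mesh (l + 1)))
    (γ := thr260 (l23Consts Γ Q C₁ C₂) D.P.d D.P.ε (D.P.mesh (l + 1)))
    (γ' := thr260 (l23Consts Γ Q C₁ C₂) D.P.d D.P.ε (D.P.mesh (l + 1)))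
    (mul_nonneg hΓ.cθ_nonneg (inv_nonneg.2 (pow_nonneg hLpos.le _)))
    (le_trans (abs_nonneg _) h59a) (le_trans (abs_nonneg _) h59a)
    (mul_nonneg (mul_nonneg hΓ.c₄_nonneg (Real.rpow_nonneg hmpos.le _)) (pFn_nonneg' hΓc hmpos hs1))
    (D.θ_lip (l + 1) z ν)
    (a := D.Ac (l + 1) ⟨blockIter (l + 1) z, μ⟩) (a' := D.Ac (l + 2) ⟨blockIter (l + 2) z, μ⟩)
    h59a (fun _ => h59b.trans (thr259_anti hΓc hd2' hmpos hs12 hs2)) (fun _ => h217z) h60a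
    (fun _ => h60b.trans (thr260_anti hΓc D.P.d D.P.hε.le hmpos hs12 hs2))
  rw [max_self] at hmain
  refine hmain.trans (le_of_eq ?_)
  exact deltaReg_eq (Γ := l23Consts Γ Q C₁ C₂) D.P.d hmpos (rfl : (D.P.L : ℝ) ^ (l + 1) * D.P.ε = D.P.mesh (l + 1))

/-- **THE COLLAR `Λ₂^{(0)} ∖ Λ₅^{(0)}` OF `Ω₁`** (`k = 1`): there `θ_m`, `m ≥ 2`, vanish at `x` and `x + εe_ν`, `θ₁(x) = 1`, so
`Ã^ε(⟨x,μ⟩) = A^{(1),ε}(⟨x,μ⟩)` and `Ã^ε(⟨x+εe_ν,μ⟩) = (1 − θ₁(x+εe_ν))A₀(…) + θ₁(x+εe_ν)A^{(1),ε}(…)`; the product rule (2.96) with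
`A₀` in the rôle of the lower configuration, (2.59)/(2.60) for `A^{(1),ε}` at `x` and the first-step restrictions on `A₀` (`Restricted0`) give
`δ₀`. [cite: Balaban1982Higgs2, (2.96)–(2.98) pp.576–577, (2.16)–(2.17) pp.559–560, Lemma 2.3 p.571] -/
theorem regular_collar_zero (H : Hyps D δ C₁ C₂) (hK : 1 ≤ D.K) (h0 : Restricted0 D (l23Consts Γ Q C₁ C₂))
    (z : HiggsLattice.Site D.P 0) (hz2 : z ∈ towerRegion D.bad (towerRad Q D.P) 0 2)
    (hz5 : z ∉ towerRegion D.bad (towerRad Q D.P) 0 5) (μ ν : Fin D.P.d) :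
    |D.toRMultiMRN.field ⟨z.shift ν, μ⟩ - D.toRMultiMRN.field ⟨z, μ⟩|
      ≤ deltaReg (l23Consts Γ Q C₁ C₂) D.P.d D.P.ε (D.P.mesh 0) := by
  have hΓc := H.valid
  have hΓ := H.hΓ
  have hr0 : ∀ j, 0 ≤ towerRad Q D.P j := towerRad_nonneg D.hR0 D.hr0 D.P
  have hn3 := D.hn3
  have hnot : ¬ D.tower.lamAt 0 z := fun h => hz5 ((lamAt_iff D (by omega) z).mp h)
  have hpl : D.θ 1 z = 1 := H.plateau 0 hK z hz2
  have hvan : ∀ m, 2 ≤ m → D.θ m z = 0 ∧ D.θ m (z.shift ν) = 0 :=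
    fun m hm => theta_eq_zero_of_not_lamAt D hnot (m := m) (by omega) ν
  -- the two values of the field
  have hFz : D.toRMultiMRN.field ⟨z, μ⟩ = D.toRMultiMRN.A 1 ⟨z, μ⟩ := by
    show field32 D.θ D.A₀ D.toRMultiMRN.A D.K ⟨z, μ⟩ = _
    rw [field32_eq_level0 D.θ D.A₀ D.toRMultiMRN.A hK z μ (fun m hm => (hvan m hm).1), hpl, sub_self, zero_mul, one_mul,
      zero_add]
    rfl
  have hFz' : D.toRMultiMRN.field ⟨z.shift ν, μ⟩
      = (1 - D.θ 1 (z.shift ν)) * D.A₀ ⟨z.shift ν, μ⟩ + D.θ 1 (z.shift ν) * D.toRMultiMRN.A 1 ⟨z.shift ν, μ⟩ :=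
    field32_eq_level0 D.θ D.A₀ D.toRMultiMRN.A hK (z.shift ν) μ (fun m hm => (hvan m hm).2)
  -- the inputs at `z`
  have hx1 : blockIter 1 z ∈ D.toRMultiMRN.L2 1 := by
    rw [RegionsDataN.toRMultiMRN_L2_succ]
    exact (blockIter_succ_mem_prime_iff 0 (n - 1) z).mpr (towerRegion_antitone (hr0 0) (by omega) hz2)
  obtain ⟨h59, h60⟩ := H.lemma23 (k := 1) le_rfl hK z hx1 μ ν
  obtain ⟨hA0, h17⟩ := h0 z hz2 hz5 μ ν
  have ht := D.θ_range 1 (z.shift ν)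
  have hlip := D.θ_lip 0 z ν
  rw [hpl] at hlip
  -- scales `s₀ = ε ≤ s₁ ≤ 1`
  have hs01 : D.P.mesh 0 ≤ D.P.mesh 1 := mesh_le_mesh (by omega)
  have hs1 : D.P.mesh 1 ≤ 1 := D.mesh_le_one hK
  have hs0 : D.P.mesh 0 ≤ 1 := hs01.trans hs1
  have hm0 := D.P.mesh_pos 0
  have hd2' := H.two_le_d
  have h59' := h59.trans (thr259_anti hΓc hd2' hm0 hs01 hs1)
  have h60' := h60.trans (thr260_anti hΓc D.P.d D.P.hε.le hm0 hs01 hs1)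
  -- abbreviations
  set t' := D.θ 1 (z.shift ν) with ht'
  set T60 := thr260 (l23Consts Γ Q C₁ C₂) D.P.d D.P.ε (D.P.mesh 0) with hT60
  set T59 := thr259 (l23Consts Γ Q C₁ C₂) D.P.d (D.P.mesh 0) with hT59
  set T17 := thr217 (l23Consts Γ Q C₁ C₂) D.P.d (D.P.mesh 0) with hT17
  have hT59_0 : 0 ≤ T59 :=
    mul_nonneg (mul_nonneg hΓc.c₃_nonneg (Real.rpow_nonneg hm0.le _)) (pFn_nonneg' hΓc hm0 hs0)
  have hT17_0 : 0 ≤ T17 :=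
    mul_nonneg (mul_nonneg hΓc.c₄_nonneg (Real.rpow_nonneg hm0.le _)) (pFn_nonneg' hΓc hm0 hs0)
  have h1t : 1 - t' ≤ Γ.cθ * ((D.P.L : ℝ) ^ 0)⁻¹ := by
    have := le_abs_self (1 - t')
    rw [abs_sub_comm] at this
    exact this.trans hlip
  have hcθ : (l23Consts Γ Q C₁ C₂).cθ = Γ.cθ := rfl
  rw [hFz, hFz']
  have key : (1 - t') * D.A₀ ⟨z.shift ν, μ⟩ + t' * D.toRMultiMRN.A 1 ⟨z.shift ν, μ⟩ - D.toRMultiMRN.A 1 ⟨z, μ⟩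
      = (1 - t') * (D.A₀ ⟨z.shift ν, μ⟩ - D.A₀ ⟨z, μ⟩) + (1 - t') * (D.A₀ ⟨z, μ⟩ - D.Ac 1 ⟨blockIter 1 z, μ⟩)
        + (1 - t') * (D.Ac 1 ⟨blockIter 1 z, μ⟩ - D.toRMultiMRN.A 1 ⟨z, μ⟩)
        + t' * (D.toRMultiMRN.A 1 ⟨z.shift ν, μ⟩ - D.toRMultiMRN.A 1 ⟨z, μ⟩) := by ring
  rw [key]
  have e1 : |(1 - t') * (D.A₀ ⟨z.shift ν, μ⟩ - D.A₀ ⟨z, μ⟩)| ≤ (1 - t') * T60 := by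
    rw [abs_mul, abs_of_nonneg (by linarith [ht.2])]
    exact mul_le_mul_of_nonneg_left hA0 (by linarith [ht.2])
  have e2 : |(1 - t') * (D.A₀ ⟨z, μ⟩ - D.Ac 1 ⟨blockIter 1 z, μ⟩)| ≤ (1 - t') * T17 := by
    rw [abs_mul, abs_of_nonneg (by linarith [ht.2]), abs_sub_comm]
    exact mul_le_mul_of_nonneg_left h17 (by linarith [ht.2])
  have e3 : |(1 - t') * (D.Ac 1 ⟨blockIter 1 z, μ⟩ - D.toRMultiMRN.A 1 ⟨z, μ⟩)| ≤ (1 - t') * T59 := by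
    rw [abs_mul, abs_of_nonneg (by linarith [ht.2]), abs_sub_comm]
    exact mul_le_mul_of_nonneg_left h59' (by linarith [ht.2])
  have e4 : |t' * (D.toRMultiMRN.A 1 ⟨z.shift ν, μ⟩ - D.toRMultiMRN.A 1 ⟨z, μ⟩)| ≤ t' * T60 := by
    rw [abs_mul, abs_of_nonneg ht.1]
    exact mul_le_mul_of_nonneg_left h60' ht.1
  have hsum : (1 - t') * (T17 + T59) ≤ Γ.cθ * ((D.P.L : ℝ) ^ 0)⁻¹ * (T17 + T59) :=
    mul_le_mul_of_nonneg_right h1t (add_nonneg hT17_0 hT59_0)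
  have hfin := deltaReg_eq (Γ := l23Consts Γ Q C₁ C₂) D.P.d hm0 (rfl : (D.P.L : ℝ) ^ 0 * D.P.ε = D.P.mesh 0)
  rw [hcθ] at hfin
  have hϑ0 : 0 ≤ Γ.cθ * ((D.P.L : ℝ) ^ 0)⁻¹ := mul_nonneg hΓ.cθ_nonneg (by norm_num)
  calc |(1 - t') * (D.A₀ ⟨z.shift ν, μ⟩ - D.A₀ ⟨z, μ⟩) + (1 - t') * (D.A₀ ⟨z, μ⟩ - D.Ac 1 ⟨blockIter 1 z, μ⟩)
        + (1 - t') * (D.Ac 1 ⟨blockIter 1 z, μ⟩ - D.toRMultiMRN.A 1 ⟨z, μ⟩)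
        + t' * (D.toRMultiMRN.A 1 ⟨z.shift ν, μ⟩ - D.toRMultiMRN.A 1 ⟨z, μ⟩)|
      ≤ |(1 - t') * (D.A₀ ⟨z.shift ν, μ⟩ - D.A₀ ⟨z, μ⟩)| + |(1 - t') * (D.A₀ ⟨z, μ⟩ - D.Ac 1 ⟨blockIter 1 z, μ⟩)|
        + |(1 - t') * (D.Ac 1 ⟨blockIter 1 z, μ⟩ - D.toRMultiMRN.A 1 ⟨z, μ⟩)|
        + |t' * (D.toRMultiMRN.A 1 ⟨z.shift ν, μ⟩ - D.toRMultiMRN.A 1 ⟨z, μ⟩)| := by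
          refine (abs_add_le _ _).trans (add_le_add ((abs_add_le _ _).trans (add_le_add (abs_add_le _ _) le_rfl)) le_rfl)
    _ ≤ (1 - t') * T60 + (1 - t') * T17 + (1 - t') * T59 + t' * T60 := add_le_add (add_le_add (add_le_add e1 e2) e3) e4
    _ = T60 + (1 - t') * (T17 + T59) := by ring
    _ ≤ T60 + Γ.cθ * ((D.P.L : ℝ) ^ 0)⁻¹ * (T17 + T59) := by linarith
    _ ≤ Γ.cθ * ((D.P.L : ℝ) ^ 0)⁻¹ * (T59 + T59 + T17) + T60 := by nlinarith
    _ = deltaReg (l23Consts Γ Q C₁ C₂) D.P.d D.P.ε (D.P.mesh 0) := hfin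

/-- **THE REGULARITY OF `Ã^ε` ON THE WHOLE OF `Ω_k = Bᵏ(Λ₂^{(k−1)′})`, `k = l + 1 = 1, …, K`** — r14's lattice form of (I.2.23),
`|Ã^ε_μ(x + εe_ν) − Ã^ε_μ(x)| ≤ δ`, at EVERY fine `x` with `x_l ∈ Λ₂^{(l)}` (the shifted point may leave `Ω_k`), with `δ = deltaReg(s_l)`,
`s_l = Lˡε = Lᵏε/L` (p. 577 *"|(∂B̃)(x)| ≦ O(1)p(Lʲε) (2.98) and it means that the regularity assumption is satisfied for the configurations B̃
and (2.93)"*; p. 579 *"this configuration satisfies the regularity assumption of Proposition I.2.1 on the basis of the estimate (2.98)"*):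
interior (`regular_interior`) + collar (`regular_collar_succ` / `regular_collar_zero`, the latter with the first-step restrictions on `A₀`).
[cite: Balaban1982Higgs2, (2.98) p.577, p.579, (2.108) p.580, (3.5) p.583] -/
theorem field_regular_omega (H : Hyps D δ C₁ C₂) (l : ℕ) (hl : l + 1 ≤ D.K) (h0 : l = 0 → Restricted0 D (l23Consts Γ Q C₁ C₂))
    (z : HiggsLattice.Site D.P 0) (hz : blockIter l z ∈ towerRegion D.bad (towerRad Q D.P) l 2) (μ ν : Fin D.P.d) :
    |D.toRMultiMRN.field ⟨z.shift ν, μ⟩ - D.toRMultiMRN.field ⟨z, μ⟩|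
      ≤ deltaReg (l23Consts Γ Q C₁ C₂) D.P.d D.P.ε (D.P.mesh l) := by
  have hΓc := H.valid
  by_cases hin : D.tower.lamAt l z
  · exact (regular_interior H l hl z hin μ ν).trans
      (deltaReg_anti hΓc D.P.d D.P.hε.le (D.P.mesh_pos l) (mesh_le_mesh (Nat.le_succ l)) (D.mesh_le_one hl))
  · have hz5 : blockIter l z ∉ towerRegion D.bad (towerRad Q D.P) l 5 := fun h => hin ((lamAt_iff D (by omega) z).mpr h)
    cases l with
    | zero => exact regular_collar_zero H hl (h0 rfl) z hz hz5 μ ν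
    | succ l => exact regular_collar_succ H l hl z hz hz5 μ ν

end Regular

/-! ## §4 The coupling smallness, and the (2.108)/(2.109) tower step of the datum with `TowerData.Reg` DISCHARGED -/

section Step

variable {n : ℕ} {Q : B2.Params} {Γ : MinConsts} {M : ℕ} {m2 : ℝ}

/-- *"for e(Lᵏε) sufficiently small"* (I p. 611 / II (2.21)) as a condition on the stopping scale for THIS file's modulus `δ = deltaReg(s_{k−1})`:
`9·d⁴·L⁴·e²·c_A²·b₀²·CmS·ε₀^{(4−d)/2} ≤ 1` (gen 10's `SmallEps` with `L⁴` for `Lᵈ` and `9` for `16`: the one coarser scale costs `L²`).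
[cite: Balaban1982Higgs2, (2.21) p.561, p.582] [cite: Balaban1982Higgs1, p.611] -/
def SmallEpsOmega (d L : ℕ) (Γc : B2Prop31Thresholds.Consts) : Prop :=
  9 * (d : ℝ) ^ 4 * (L : ℝ) ^ 4 * Γc.e ^ 2 * Γc.cA ^ 2 * Γc.b₀ ^ 2 * CmS Γc d * Γc.ε₀ ^ (((4 : ℝ) - d) / 2) ≤ 1

/-- **The coupling smallness of r14's regular-region theorems from the thresholds**: for `d ≤ 3`, `0 < s ≤ ε₀`, `s = ℓ·ε`, under
`SmallEpsOmega`: `d²·(ε|e|)·(Lℓ)²·deltaReg(s) ≤ 1/3` (its square is `d⁴e²L⁴·s²ℓ²δ(s)² ≤ d⁴e²L⁴c_A²b₀²·CmS·ε₀^{(4−d)/2} ≤ 1/9`, log powers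
against powers as in gen 10's `small_of_thresholds`). [cite: Balaban1982Higgs2, (2.21) p.561, (3.29) p.590] [cite: Balaban1982Higgs1, p.611] -/
theorem small_omega {Γc : B2Prop31Thresholds.Consts} (h : Γc.Valid) {d L : ℕ} (hd : d ≤ 3) (hsm : SmallEpsOmega d L Γc)
    {ε s ℓ : ℝ} (hε : 0 ≤ ε) (hs : 0 < s) (hsε : s ≤ Γc.ε₀) (hℓ : ℓ * ε = s) :
    (d : ℝ) ^ 2 * (ε * |Γc.e|) * ((L : ℝ) * ℓ) ^ 2 * deltaReg Γc d ε s ≤ 1 / 3 := by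
  have hs1 : s ≤ 1 := hsε.trans h.ε₀_le_one
  have hd' : (d : ℝ) ≤ 3 := by exact_mod_cast hd
  set σ : ℝ := ((4 : ℝ) - d) / 2 with hσ
  have hσ0 : 0 < σ := by rw [hσ]; linarith
  have hkey := B2Sect3AGaussianStep.one_add_log_inv_rpow_mul_rpow_le (p := 2 * Γc.p) (s := σ)
    (by linarith [h.p_pos]) hσ0 hs hs1
  have hsplit : s ^ ((2 : ℝ) - d) * s ^ 2 = s ^ σ * s ^ σ := by
    rw [show s ^ 2 = s ^ ((2 : ℕ) : ℝ) from (Real.rpow_natCast s 2).symm, ← Real.rpow_add hs, ← Real.rpow_add hs, hσ]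
    norm_num; ring_nf
  have hsσ : s ^ σ ≤ Γc.ε₀ ^ σ := Real.rpow_le_rpow hs.le hsε hσ0.le
  have hsσ0 : 0 ≤ s ^ σ := Real.rpow_nonneg hs.le _
  have hC : 0 ≤ CmS Γc d := by unfold CmS; positivity
  have hmain : s ^ 2 * (ℓ ^ 2 * deltaReg Γc d ε s ^ 2) ≤ Γc.cA ^ 2 * Γc.b₀ ^ 2 * CmS Γc d * Γc.ε₀ ^ σ := by
    rw [sq_Lk_deltaReg d hs hℓ, pFn_sq hs hs1]
    calc s ^ 2 * (Γc.cA ^ 2 * s ^ ((2 : ℝ) - d) * (Γc.b₀ ^ 2 * (1 + Real.log s⁻¹) ^ (2 * Γc.p)))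
        = Γc.cA ^ 2 * Γc.b₀ ^ 2 * ((1 + Real.log s⁻¹) ^ (2 * Γc.p) * s ^ σ) * s ^ σ := by
          rw [show s ^ 2 * (Γc.cA ^ 2 * s ^ ((2 : ℝ) - d) * (Γc.b₀ ^ 2 * (1 + Real.log s⁻¹) ^ (2 * Γc.p)))
              = Γc.cA ^ 2 * Γc.b₀ ^ 2 * (1 + Real.log s⁻¹) ^ (2 * Γc.p) * (s ^ ((2 : ℝ) - d) * s ^ 2) by ring, hsplit]
          ring
      _ ≤ Γc.cA ^ 2 * Γc.b₀ ^ 2 * CmS Γc d * Γc.ε₀ ^ σ := by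
          have : (1 + Real.log s⁻¹) ^ (2 * Γc.p) * s ^ σ ≤ CmS Γc d := hkey
          gcongr
  have hδ0 : 0 ≤ deltaReg Γc d ε s := by
    unfold deltaReg
    exact mul_nonneg (mul_nonneg (mul_nonneg (Consts.cA_nonneg h) hε) (Real.rpow_nonneg hs.le _)) (pFn_nonneg' h hs hs1)
  set X := (d : ℝ) ^ 2 * (ε * |Γc.e|) * ((L : ℝ) * ℓ) ^ 2 * deltaReg Γc d ε s with hX
  have hX0 : 0 ≤ X := by
    rw [hX]
    exact mul_nonneg (mul_nonneg (mul_nonneg (pow_nonneg (Nat.cast_nonneg _) _) (mul_nonneg hε (abs_nonneg _))) (sq_nonneg _)) hδ0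
  have habs : |Γc.e| ^ 2 = Γc.e ^ 2 := sq_abs _
  have hX2 : X ^ 2 ≤ (1 / 3) ^ 2 := by
    have hXe : X ^ 2 = (d : ℝ) ^ 4 * (L : ℝ) ^ 4 * Γc.e ^ 2 * (s ^ 2 * (ℓ ^ 2 * deltaReg Γc d ε s ^ 2)) := by
      rw [hX, ← habs, ← hℓ]; ring
    rw [hXe]
    have hpre : 0 ≤ (d : ℝ) ^ 4 * (L : ℝ) ^ 4 * Γc.e ^ 2 := by positivity
    calc (d : ℝ) ^ 4 * (L : ℝ) ^ 4 * Γc.e ^ 2 * (s ^ 2 * (ℓ ^ 2 * deltaReg Γc d ε s ^ 2))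
        ≤ (d : ℝ) ^ 4 * (L : ℝ) ^ 4 * Γc.e ^ 2 * (Γc.cA ^ 2 * Γc.b₀ ^ 2 * CmS Γc d * Γc.ε₀ ^ σ) :=
          mul_le_mul_of_nonneg_left hmain hpre
      _ = (9 * (d : ℝ) ^ 4 * (L : ℝ) ^ 4 * Γc.e ^ 2 * Γc.cA ^ 2 * Γc.b₀ ^ 2 * CmS Γc d * Γc.ε₀ ^ σ) / 9 := by ring
      _ ≤ 1 / 9 := by rw [hσ]; exact div_le_div_of_nonneg_right hsm (by norm_num)
      _ = (1 / 3) ^ 2 := by norm_num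
  exact (pow_le_pow_iff_left₀ hX0 (by norm_num) two_ne_zero).mp hX2

/-- **THE (2.108)/(2.109) STEP `k = l + 1` OF THE DATUM** as a `B2Ineq2109HiggsLatticeTower.TowerData`: level `j = l`, the datum's charge data,
THE §3 FIELD `B̃ := Ã^ε` (3.2) of the datum (`RMultiMRN.field` = `field32` of its cut-offs, `A₀` and (3.3) minimizers), a mass `m² > 0`, the
DERIVED modulus `δ_A := deltaReg(s_l)`, the datum's large-field points and radii `r(Lˡε)` — so that the six sets of (2.108) are the datum's own
`Λ₂^{(l)′} ⊇ Λ₆^{(l)′} ⊇ Λ₃^{(l+1)} ⊇ Λ₄^{(l+1)} ⊇ Λ₅^{(l+1)}`, `Λ₂^{(l+1)}`. [cite: Balaban1982Higgs2, (2.108) p.580, (3.2) p.583, (3.5) p.583, p.579] -/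
def towerStep (D : RegionsDataN n Q Γ M m2) (Γc : B2Prop31Thresholds.Consts) (l : ℕ) (hl : l + 1 ≤ D.K) (msq : ℝ)
    (hmsq : 0 < msq) : TowerData D.P D.N where
  j := l
  hjK := hl.trans D.hK
  C := D.C
  A := D.toRMultiMRN.field
  msq := msq
  hmsq := hmsq
  dA := deltaReg Γc D.P.d D.P.ε (D.P.mesh l)
  bad := D.bad
  rad := towerRad Q D.P
  hrad0 := towerRad_nonneg D.hR0 D.hr0 D.P l
  hrad1 := towerRad_nonneg D.hR0 D.hr0 D.P (l + 1)

/-- the field of the step is the datum's `Ã^ε` (definitional). [cite: Balaban1982Higgs2, (3.2) p.583] -/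
theorem towerStep_A (D : RegionsDataN n Q Γ M m2) (Γc : B2Prop31Thresholds.Consts) (l : ℕ) (hl : l + 1 ≤ D.K) (msq : ℝ)
    (hmsq : 0 < msq) : (towerStep D Γc l hl msq hmsq).A = D.toRMultiMRN.field := rfl

/-- the regularity modulus of the step is `deltaReg(s_l)` (definitional). [cite: Balaban1982Higgs2, (2.98) p.577] -/
theorem towerStep_dA (D : RegionsDataN n Q Γ M m2) (Γc : B2Prop31Thresholds.Consts) (l : ℕ) (hl : l + 1 ≤ D.K) (msq : ℝ)
    (hmsq : 0 < msq) : (towerStep D Γc l hl msq hmsq).dA = deltaReg Γc D.P.d D.P.ε (D.P.mesh l) := rfl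

/-- `Ω = Bᵏ(Λ₂^{(k−1)′})` of the step in block labels: `x ∈ Ω ↔ x_l ∈ Λ₂^{(l)}`. [cite: Balaban1982Higgs2, (2.108) p.580] -/
theorem mem_Ω_towerStep (D : RegionsDataN n Q Γ M m2) (Γc : B2Prop31Thresholds.Consts) (l : ℕ) (hl : l + 1 ≤ D.K) (msq : ℝ)
    (hmsq : 0 < msq) (x : HiggsLattice.Site D.P 0) :
    x ∈ (towerStep D Γc l hl msq hmsq).toInst.Ω ↔ blockIter l x ∈ towerRegion D.bad (towerRad Q D.P) l 2 :=
  (TowerData.mem_Ω _ x).trans (blockIter_succ_mem_prime_iff l 2 x)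

variable {D : RegionsDataN n Q Γ M m2} {δ C₁ C₂ : ℝ}

/-- **`TowerData.Reg` DISCHARGED FOR THE STEP OF THE DATUM** — the last standing hypothesis of `B2Ineq2109HiggsLatticeTower` (r14's lattice
form of (I.2.23) on `Ω = Bᵏ(Λ₂^{(k−1)′})` + the coupling smallness *"for e(Lᵏε) sufficiently small"*): from the standing inputs `Hyps`, the
first-step restrictions on `A₀` when `k = 1`, `d ≤ 3` and `SmallEpsOmega`; for every mass and every family parameter `a`.
[cite: Balaban1982Higgs2, (2.98) p.577, p.579, (2.108)–(2.109) p.580, (2.21) p.561] -/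
theorem reg_towerStep (H : Hyps D δ C₁ C₂) (l : ℕ) (hl : l + 1 ≤ D.K) (h0 : l = 0 → Restricted0 D (l23Consts Γ Q C₁ C₂))
    (hd3 : Q.d ≤ 3) (hsm : SmallEpsOmega Q.d Q.L (l23Consts Γ Q C₁ C₂)) {msq : ℝ} (hmsq : 0 < msq) (a : ℝ) :
    TowerData.Reg a (towerStep D (l23Consts Γ Q C₁ C₂) l hl msq hmsq) where
  reg z hz μ ν := field_regular_omega H l hl h0 z ((mem_Ω_towerStep D _ l hl msq hmsq z).mp hz) μ ν
  small := by
    show (D.P.d : ℝ) ^ 2 * (D.P.mesh 0 * |D.C.e|) * ((D.P.L : ℝ) ^ (l + 1)) ^ 2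
      * deltaReg (l23Consts Γ Q C₁ C₂) D.P.d D.P.ε (D.P.mesh l) ≤ 1 / 3
    have hmesh0 : D.P.mesh 0 = D.P.ε := by
      show (D.P.L : ℝ) ^ 0 * D.P.ε = D.P.ε
      rw [pow_zero, one_mul]
    have he : D.C.e = (l23Consts Γ Q C₁ C₂).e := D.hCe
    have hd' : D.P.d ≤ 3 := by rw [D.hd]; exact hd3
    have hsm' : SmallEpsOmega D.P.d D.P.L (l23Consts Γ Q C₁ C₂) := by rw [D.hd, D.hL]; exact hsm
    rw [hmesh0, he, pow_succ' (D.P.L : ℝ) l]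
    exact small_omega H.valid hd' hsm' D.P.hε.le (D.P.mesh_pos l)
      ((mesh_le_mesh (show l ≤ D.K by omega)).trans D.hε₀) rfl

end Step

/-! ## §5 Consequences: the datum's step is a member of the tower family — (2.109)₁ = (3.8), (2.109)₂, the (2.108) error term — and the
plateau property of the constructed `θ_k` -/

section Consequences

open scoped Matrix

variable {n : ℕ} {Q : B2.Params} {Γ : MinConsts} {M : ℕ} {m2 : ℝ} {D : RegionsDataN n Q Γ M m2} {δ C₁ C₂ : ℝ}

/-- **THE DATUM'S STEP AS AN INDEX OF THE TOWER FAMILY** of `B2Ineq2109HiggsLatticeTower` (`TowerIdx d L a` = torus + `N` + step data +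
`Reg`): the family over which `ineq2109_tower : B2Sect2Statements.Ineq2109 …` / `ineq38_tower : B2Sect3AStatements.Ineq38 …` /
`norm_Hk_le_tower` ((3.12)) are proved CONTAINS the (2.108)/(3.5) steps of the constructed Prop-3.1 data with their genuine §3 field `Ã^ε`.
[cite: Balaban1982Higgs2, (2.109) p.580, (3.8) p.584, (3.12) p.586] -/
def towerIdxOfData (H : Hyps D δ C₁ C₂) (l : ℕ) (hl : l + 1 ≤ D.K) (h0 : l = 0 → Restricted0 D (l23Consts Γ Q C₁ C₂))
    (hd3 : Q.d ≤ 3) (hsm : SmallEpsOmega Q.d Q.L (l23Consts Γ Q C₁ C₂)) {msq : ℝ} (hmsq : 0 < msq) : TowerIdx Q.d Q.L Q.a :=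
  ⟨D.P, D.hd, D.hL, D.N, towerStep D (l23Consts Γ Q C₁ C₂) l hl msq hmsq, reg_towerStep H l hl h0 hd3 hsm hmsq Q.a⟩

/-- the index is the datum's step (definitional). [cite: Balaban1982Higgs2, (2.109) p.580] -/
theorem towerIdxOfData_t (H : Hyps D δ C₁ C₂) (l : ℕ) (hl : l + 1 ≤ D.K) (h0 : l = 0 → Restricted0 D (l23Consts Γ Q C₁ C₂))
    (hd3 : Q.d ≤ 3) (hsm : SmallEpsOmega Q.d Q.L (l23Consts Γ Q C₁ C₂)) {msq : ℝ} (hmsq : 0 < msq) :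
    (towerIdxOfData H l hl h0 hd3 hsm hmsq).t = towerStep D (l23Consts Γ Q C₁ C₂) l hl msq hmsq := rfl

/-- **(2.109)₁ = (3.8) POINTWISE FOR THE `H_k` OF THE DATUM'S STEP WITH ITS GENUINE FIELD `Ã^ε`** — no field-regularity hypothesis:
`|h_k(x,x′)| ≤ (c₀^{(2.27)} + c₀^{(2.29)})(Lᵏε)⁻² e^{−(δ/2)r(Lᵏε)} e^{−(δ/2)|x − x′|}` for every `δ ≥ 0` with `(4d + 4a)δ ≤ γ₀`
(`B2Ineq2109HiggsLatticeTower.abs_hk_le_tower` ∘ `reg_towerStep`). [cite: Balaban1982Higgs2, (2.109) p.580, (3.8) p.584] -/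
theorem abs_hk_le_ofData (H : Hyps D δ C₁ C₂) (l : ℕ) (hl : l + 1 ≤ D.K) (h0 : l = 0 → Restricted0 D (l23Consts Γ Q C₁ C₂))
    (hd3 : Q.d ≤ 3) (hsm : SmallEpsOmega Q.d Q.L (l23Consts Γ Q C₁ C₂)) {msq : ℝ} (hmsq : 0 < msq)
    {dd : ℝ} (hdd0 : 0 ≤ dd) (hdd : (4 * D.P.d + 4 * Q.a) * dd ≤ gam D.P.L Q.a)
    (p q : ↥(towerStep D (l23Consts Γ Q C₁ C₂) l hl msq hmsq).toInst.L6 × B1Eq230FluctCov.Ix D.N) :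
    |(towerStep D (l23Consts Γ Q C₁ C₂) l hl msq hmsq).toInst.hk Q.a p q|
      ≤ (c227 D.P.L Q.a dd + c229 D.P.d D.P.L Q.a dd) * (D.P.mesh (l + 1))⁻¹ ^ 2 *
        Real.exp (-(dd / 2 * towerRad Q D.P (l + 1))) * Real.exp (-(dd / 2 * (HiggsLattice.Site.tdist p.1.1 q.1.1 : ℝ))) :=
  B2Ineq2109HiggsLatticeTower.abs_hk_le_tower _ H.ha D.S.hL.2 (reg_towerStep H l hl h0 hd3 hsm hmsq Q.a) hdd0 hdd p q

/-- **(2.109), SECOND INEQUALITY, FOR THE DATUM'S STEPS** *"≤ O((Lᵏε)^κ)exp(−δ₀|x − x′|) … for … arbitrary κ"* (unit-lattice kernel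
`(Lᵏε)²h_k`, radii `r(Lᵏε)` of (2.7) with the printed ranges): one `δ₀` per `(d, L, a)`, for every `κ` one `C′` per step
(`B2Ineq2109HiggsLattice.ineq2109_pow_higgsLattice` at the step's instance). [cite: Balaban1982Higgs2, (2.109) p.580, (2.7) p.558] -/
theorem hkUnit_le_pow_ofData (hQ : Q.Printed) :
    ∃ δ₀ : ℝ, 0 < δ₀ ∧ ∀ (D : RegionsDataN n Q Γ M m2) (δ C₁ C₂ : ℝ) (H : Hyps D δ C₁ C₂) (l : ℕ) (hl : l + 1 ≤ D.K)
      (h0 : l = 0 → Restricted0 D (l23Consts Γ Q C₁ C₂)) (hd3 : Q.d ≤ 3) (hsm : SmallEpsOmega Q.d Q.L (l23Consts Γ Q C₁ C₂))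
      (msq : ℝ) (hmsq : 0 < msq) (κ : ℝ), ∃ C' : ℝ,
        ∀ p q : ↥(towerStep D (l23Consts Γ Q C₁ C₂) l hl msq hmsq).toInst.L6 × B1Eq230FluctCov.Ix D.N,
          |(towerStep D (l23Consts Γ Q C₁ C₂) l hl msq hmsq).toInst.hkUnit Q.a p q|
            ≤ C' * D.P.mesh (l + 1) ^ κ * Real.exp (-(δ₀ * (HiggsLattice.Site.tdist p.1.1 q.1.1 : ℝ))) := by
  obtain ⟨δ₀, hδ₀, h⟩ := B2Ineq2109HiggsLattice.ineq2109_pow_higgsLattice Q.d Q.L hQ.2.2.1 hQ.2.2.2.2.1 Q hQ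
  refine ⟨δ₀, hδ₀, fun D δ C₁ C₂ H l hl h0 hd3 hsm msq hmsq κ => ?_⟩
  exact h D.P D.hd D.hL D.N _ (TowerData.adm_toInst _ (reg_towerStep H l hl h0 hd3 hsm hmsq Q.a)) (D.P.mesh_pos _)
    (D.mesh_le_one hl) (towerRad_eq (D.mesh_le_one hl)) κ

/-- **THE `O((Lᵏε)^κ)|Λ₃^{(k)}|` SIZE OF THE `H_k`-FORM (2.108) FOR THE DATUM'S STEP** (bounded scalar fields `|φ| ≤ s` on `Λ₆^{(k−1)′}`):
`|⟨φ, H_kφ⟩| ≤ (c₀^{(2.27)} + c₀^{(2.29)})·N²·K_W·(Lᵏε)⁻⁴·s²·e^{−(δ/2)r(Lᵏε)}·|Λ₃^{(k)}|` (gen 15's `abs_form_hk_le_tower` ∘ `reg_towerStep`).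
[cite: Balaban1982Higgs2, (2.108) p.580] -/
theorem abs_form_hk_le_ofData (H : Hyps D δ C₁ C₂) (l : ℕ) (hl : l + 1 ≤ D.K) (h0 : l = 0 → Restricted0 D (l23Consts Γ Q C₁ C₂))
    (hd3 : Q.d ≤ 3) (hsm : SmallEpsOmega Q.d Q.L (l23Consts Γ Q C₁ C₂)) {msq : ℝ} (hmsq : 0 < msq)
    {dd : ℝ} (hdd0 : 0 < dd) (hdd : (4 * D.P.d + 4 * Q.a) * dd ≤ gam D.P.L Q.a) {s : ℝ}
    (φ : ↥(towerStep D (l23Consts Γ Q C₁ C₂) l hl msq hmsq).toInst.L6 × B1Eq230FluctCov.Ix D.N → ℝ) (hφ : ∀ p, |φ p| ≤ s) :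
    |φ ⬝ᵥ ((towerStep D (l23Consts Γ Q C₁ C₂) l hl msq hmsq).toInst.Hk Q.a *ᵥ φ)|
      ≤ (c227 D.P.L Q.a dd + c229 D.P.d D.P.L Q.a dd) * (Fintype.card (B1Eq230FluctCov.Ix D.N) : ℝ) ^ 2 *
        B2Eq2108ErrorHiggsLattice.KW D.P.d dd * (D.P.mesh (l + 1))⁻¹ ^ 2 * s ^ 2 *
          Real.exp (-(dd / 2 * towerRad Q D.P (l + 1))) * ((towerRegion D.bad (towerRad Q D.P) (l + 1) 3).card : ℝ) :=
  B2Ineq2109HiggsLatticeTower.abs_form_hk_le_tower _ H.ha D.S.hL.2 (reg_towerStep H l hl h0 hd3 hsm hmsq Q.a) hdd0 hdd φ hφ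

/-- **THE PLATEAU PROPERTY HOLDS FOR THE CONSTRUCTED CUT-OFFS**: gen 13's datum `RegionsDataN.ofFields` (`θ_k := thetaOf`, `n ≤ 2`) satisfies
`Plateau` — `thetaOf_eq_one_of_mem` (*"equal to 1 on B^{k−1}(Λ₂^{(k−1)})"*). [cite: Balaban1982Higgs2, p.567] -/
theorem plateau_ofFields (hn1 : 1 ≤ n) (hn2 : n ≤ 2) (P : HiggsLattice.Params) (hPL : P.L = Q.L) (hPd : P.d = Q.d) (hPM : P.M = M)
    (S : Shape P) (N K : ℕ) (hK : K ≤ P.K) (hε₀ : P.mesh K ≤ Γ.ε₀) (hmesh1 : P.mesh K ≤ 1)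
    (hRn : (P.L : ℝ) / n * (2 * (P.M : ℝ) + 8) ≤ Q.R) (hr : 1 ≤ Q.r) (hcθ : 1 ≤ Γ.cθ * (P.M : ℝ))
    (bad : (j : ℕ) → Set (HiggsLattice.Site P j)) (C : ChargeData N) (hCe : C.e = Γ.e) (A₀ : HiggsLattice.VecField P 0)
    (Ac : (k : ℕ) → HiggsLattice.VecField P k) (Φ : Cfg (dataTowerN n hn1 Q P hRn hr bad K).regions N) :
    Plateau (RegionsDataN.ofFields (Γ := Γ) (m2 := m2) hn1 hn2 P hPL hPd hPM S N K hK hε₀ hmesh1 hRn hr hcθ bad C hCe A₀ Ac Φ) :=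
  fun _ hl _ hz => thetaOf_eq_one_of_mem hl (mem_plateau.mpr hz)

end Consequences

/-! ## §6 (v1.1) Non-vacuity: the standing inputs, the first-step restrictions and a NON-ZERO §3 field, jointly -/

section NonVacuity

open Literature.MathematicalPhysics.QuantumFieldTheory.Balaban1983to89.B2Prop31MinimizerWitness (chargeW kappaW kappaW_nonneg)
open Literature.MathematicalPhysics.QuantumFieldTheory.Balaban1983to89.B2Prop31MinimizerFamily (exists_lemma23Bounds)
open Literature.MathematicalPhysics.QuantumFieldTheory.Balaban1983to89.B2Prop31MinimizerRegionsNonzero (norm_cutMin_const_sub_lt_rad)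
open Literature.MathematicalPhysics.QuantumFieldTheory.Balaban1983to89.B2Eq244Cutoff (zeta244)
open Literature.MathematicalPhysics.QuantumFieldTheory.Balaban1983to89.B2Eq245ThetaNonzero
  (ofFields_field_plateau ofFieldsConst_restrictedM)

variable {n : ℕ} {Q : B2.Params} {Γ : MinConsts} {M : ℕ} {m2 : ℝ}

variable (hn1 : 1 ≤ n) (hn2 : n ≤ 2) (hΓ : Γ.Valid) (P : HiggsLattice.Params) (hPL : P.L = Q.L) (hPd : P.d = Q.d) (hPM : P.M = M)
  (S : Shape P) (K : ℕ) (hK : K ≤ P.K) (hε₀ : P.mesh K ≤ Γ.ε₀) (hRn : (P.L : ℝ) / n * (2 * (P.M : ℝ) + 8) ≤ Q.R) (hr : 1 ≤ Q.r)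
  (hcθ : 1 ≤ Γ.cθ * (P.M : ℝ)) (bad : (j : ℕ) → Set (HiggsLattice.Site P j)) (v : EuclideanSpace ℝ (Fin P.d))

/-- **THE WITNESS DATUM**: gen 13's `RegionsDataN.ofFields` (`θ_k := thetaOf`, regions = the (2.7)–(2.8) tower of `bad`, `K` steps, one scalar
component, charge `chargeW`) with the CONSTANT block fields `A_k ≡ v` AND the constant fine field `A₀ ≡ v` (so that the first-step restrictions
`Restricted0` hold with room), `Φ = 0`. [cite: Balaban1982Higgs2, Prop. 3.1 p.589, (3.2) p.583, p.567, (2.43) p.566] -/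
def constData : RegionsDataN n Q Γ M m2 :=
  RegionsDataN.ofFields (Γ := Γ) (m2 := m2) hn1 hn2 P hPL hPd hPM S 1 K hK hε₀ (hε₀.trans hΓ.ε₀_le_one) hRn hr hcθ bad
    (chargeW Γ.e) rfl (fun b => v b.dir) (fun k => ofSite fun _ : HiggsLattice.Site P k => v) 0

/-- The witness lives on the given torus (definitional). [cite: Balaban1982Higgs1, (1.2) p.604] -/
theorem constData_P : (constData (m2 := m2) hn1 hn2 hΓ P hPL hPd hPM S K hK hε₀ hRn hr hcθ bad v).P = P := rfl

/-- Its number of steps is `K` (definitional). [cite: Balaban1982Higgs2, p.582] -/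
theorem constData_K : (constData (m2 := m2) hn1 hn2 hΓ P hPL hPd hPM S K hK hε₀ hRn hr hcθ bad v).K = K := rfl

/-- **The witness satisfies the printed restrictions `restrictedM`** once `‖v‖ ≤ thrA(Lᵏε)` for `k ≤ K` — gen 13's `ofFieldsConst_restrictedM`
(its datum has `A₀ = 0`; `restrictedM` does not involve `A₀`). [cite: Balaban1982Higgs2, (2.55) p.570, Prop. 3.1 p.589] -/
theorem constData_restrictedM (hv : ∀ k, 1 ≤ k → k ≤ K → ‖v‖ ≤ Γ.thrA P.d (P.mesh k)) :
    (constData (m2 := m2) hn1 hn2 hΓ P hPL hPd hPM S K hK hε₀ hRn hr hcθ bad v).toRMultiMRN.restrictedM :=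
  ofFieldsConst_restrictedM (m2 := m2) hn1 hn2 hΓ P hPL hPd hPM S K hK hε₀ hRn hr hcθ bad v hv

/-- **The witness has the plateau property** (`θ := thetaOf`). [cite: Balaban1982Higgs2, p.567] -/
theorem constData_plateau : Plateau (constData (m2 := m2) hn1 hn2 hΓ P hPL hPd hPM S K hK hε₀ hRn hr hcθ bad v) :=
  plateau_ofFields hn1 hn2 P hPL hPd hPM S 1 K hK hε₀ (hε₀.trans hΓ.ε₀_le_one) hRn hr hcθ bad (chargeW Γ.e) rfl _ _ 0

/-- **The witness satisfies the first-step restrictions `Restricted0`** for every valid thresholds record: `A₀ ≡ v ≡ A₁` makes both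
differences vanish. [cite: Balaban1982Higgs2, (2.16)–(2.17) pp.559–560] -/
theorem constData_restricted0 {Γc : B2Prop31Thresholds.Consts} (hΓc : Γc.Valid) :
    Restricted0 (constData (m2 := m2) hn1 hn2 hΓ P hPL hPd hPM S K hK hε₀ hRn hr hcθ bad v) Γc := by
  intro z _ _ μ ν
  have hm0 : 0 < P.mesh 0 := P.mesh_pos 0
  have hs0 : P.mesh 0 ≤ 1 := ((mesh_le_mesh (Nat.zero_le K)).trans hε₀).trans hΓ.ε₀_le_one
  have hp := pFn_nonneg' hΓc hm0 hs0
  constructor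
  · show |v μ - v μ| ≤ thr260 Γc P.d P.ε (P.mesh 0)
    rw [sub_self, abs_zero]
    exact mul_nonneg (mul_nonneg (mul_nonneg hΓc.c₅_nonneg P.hε.le) (Real.rpow_nonneg hm0.le _)) hp
  · show |v μ - v μ| ≤ thr217 Γc P.d (P.mesh 0)
    rw [sub_self, abs_zero]
    exact mul_nonneg (mul_nonneg hΓc.c₄_nonneg (Real.rpow_nonneg hm0.le _)) hp

/-- **The witness has a NON-ZERO §3 field** whenever some fine point lies in `B^{K−1}(Λ₂^{(K−1)})`, `v ≠ 0`, `κ·Lᴷε < 1` and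
`R ≥ (L/n)(2/δ + 2M + 2)` — gen 13's argument (`B2Eq245ThetaNonzero.ofFieldsConst_field_ne_zero`) verbatim for the datum with `A₀ ≡ v`: on the
plateau the field IS the top (3.3) minimizer of the constant block field (`ofFields_field_plateau`), which p320224's Lemma 2.3 with `q = 0`
keeps within `< ‖v‖` of `v`. [cite: Balaban1982Higgs2, Prop. 3.1 p.589, (3.2)–(3.3) p.583, Lemma 2.3 p.571, p.567] -/
theorem constData_field_ne_zero (hQa : 0 < Q.a) {δ C₁ C₂ : ℝ} (pkg : Lemma23Bounds Q.d Q.L Q.a Γ.μ0sq Γ.ε₀ δ C₁ C₂) (hδ : 0 < δ)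
    (hC₂ : 0 ≤ C₂) (hRδ : (P.L : ℝ) / n * (2 / δ + 2 * (P.M : ℝ) + 2) ≤ Q.R) (hsmall : kappaW Q.a Q.L Γ.μ0sq C₂ * P.mesh K < 1)
    (hv : v ≠ 0) {i : ℕ} (hKi : K = i + 1) {x : HiggsLattice.Site P 0} (hx : blockIter i x ∈ towerRegion bad (towerRad Q P) i 2) :
    (constData (m2 := m2) hn1 hn2 hΓ P hPL hPd hPM S K hK hε₀ hRn hr hcθ bad v).toRMultiMRN.field ≠ 0 := by
  intro h0
  set D := constData (m2 := m2) hn1 hn2 hΓ P hPL hPd hPM S K hK hε₀ hRn hr hcθ bad v with hD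
  have hK1 : 1 ≤ K := by omega
  have hs1 : P.mesh K ≤ 1 := hε₀.trans hΓ.ε₀_le_one
  have hE : Real.exp (-(δ * (radN n Q.R Q.r P K / 2))) ≤ P.mesh K := exp_neg_delta_radN_le hn1 hK1 hs1 hδ hRδ hr
  have hρ0 : 0 ≤ radN n Q.R Q.r P K := by
    have h6 : 6 ≤ radN n Q.R Q.r P K := six_le_radN hn1 hK1 hs1 hRn hr
    linarith
  have hn3 : n - 1 ≤ 2 := by omega
  have hx' : blockIter K x ∈ D.toRMultiMRN.L2 K := by
    subst hKi
    show blockIter (i + 1) x ∈ prime (towerRegion bad (towerRad Q P) i (n - 1))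
    have hr0 : 0 ≤ towerRad Q P i := towerRad_nonneg (R_pos_ofN hn1 hRn).le (zero_le_one.trans hr) P i
    exact (blockIter_succ_mem_prime_iff i (n - 1) x).mpr (towerRegion_antitone hr0 hn3 hx)
  have hlt := norm_cutMin_const_sub_lt_rad hQa hΓ.μ0sq_pos pkg hC₂ S hPd hPL (k := K) hK1 hK hε₀ hs1 hρ0 hE
    (zeta244 P K (radN n Q.R Q.r P K)) (D.toRMultiMRN.ζ_abs K hK1 le_rfl) (D.toRMultiMRN.ζ_supp K hK1 le_rfl)
    (D.toRMultiMRN.ζ_one K hK1 le_rfl) (D.toRMultiMRN.ζ_lip K hK1 le_rfl) (D.toRMultiMRN.L1 K) (D.toRMultiMRN.L2 K)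
    (D.toRMultiMRN.L2_sub K) (D.toRMultiMRN.nbhd K hK1 le_rfl) hsmall hv x hx'
  have hne : cutMin (zeroCharge P.d) Γ.μ0sq Q.a K (zeta244 P K (radN n Q.R Q.r P K)) (fun _ => v) x ≠ 0 := by
    intro hz
    rw [hz, zero_sub, norm_neg] at hlt
    exact lt_irrefl _ hlt
  apply hne
  ext μ
  have hb : D.toRMultiMRN.field (⟨x, μ⟩ : HiggsLattice.PBond P 0) = 0 := by rw [h0]; rfl
  have hplat := ofFields_field_plateau (Γ := Γ) (m2 := m2) hn1 hn2 P hPL hPd hPM S 1 K hK hε₀ (hε₀.trans hΓ.ε₀_le_one) hRn hr hcθ bad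
    (chargeW Γ.e) rfl (fun b => v b.dir) (fun k => ofSite fun _ : HiggsLattice.Site P k => v) 0 hKi ⟨x, μ⟩ hx
  rw [toSite_ofSite] at hplat
  have hb' := hplat.symm.trans hb
  rw [hb']
  rfl

/-- **The witness satisfies the standing inputs `Hyps`** (with the Lemma-2.3 constants of the package, `R` large, `v` small).
[cite: Balaban1982Higgs2, Prop. 3.1 p.589, (2.55) p.570, (2.7) p.558, p.567] -/
theorem constData_hyps (hQa : 0 < Q.a) (hd2 : 2 ≤ Q.d) {δ C₁ C₂ : ℝ} (pkg : Lemma23Bounds Q.d Q.L Q.a Γ.μ0sq Γ.ε₀ δ C₁ C₂)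
    (hδ : 0 < δ) (hC₁ : 0 ≤ C₁) (hC₂ : 0 ≤ C₂) (hR : (Q.L : ℝ) / n * (2 / δ + 2 * (M : ℝ) + 2) ≤ Q.R)
    (hv : ∀ k, 1 ≤ k → k ≤ K → ‖v‖ ≤ Γ.thrA P.d (P.mesh k)) :
    Hyps (constData (m2 := m2) hn1 hn2 hΓ P hPL hPd hPM S K hK hε₀ hRn hr hcθ bad v) δ C₁ C₂ :=
  ⟨hΓ, hQa, hd2, pkg, hδ, hC₁, hC₂, hR, constData_restrictedM hn1 hn2 hΓ P hPL hPd hPM S K hK hε₀ hRn hr hcθ bad v hv,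
    constData_plateau hn1 hn2 hΓ P hPL hPd hPM S K hK hε₀ hRn hr hcθ bad v⟩

/-- **NON-VACUITY OF THE FILE'S HYPOTHESES WITH A NON-ZERO FIELD, AT EVERY NUMBER OF STEPS** (`1 ≤ n ≤ 2`, `d ≥ 2`, `c_θ·M ≥ 1`): there are
Lemma-2.3 constants `(δ, C₁, C₂)` and `R₁, s₁ > 0` (`s₁ ≤ ε₀`) such that for every parameter set with `d, L, a` fixed, `R ≥ R₁`, `r ≥ 1`, every torus of
the sub-family with `M`-blocks, every `1 ≤ K ≤` the lattice's with `Lᴷε ≤ s₁`, every large-field configuration, every `v ≠ 0` with `‖v‖ ≤ thrA(Lᵏε)`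
(`k ≤ K`), and every fine point of `B^{K−1}(Λ₂^{(K−1)})`, the witness datum satisfies `Hyps` (with these constants), `Restricted0` for EVERY valid
thresholds record (in particular `l23Consts Γ Q C₁ C₂`), AND has a non-zero §3 field `Ã^ε` — so `reg_towerStep`/`abs_hk_le_ofData` speak about an
inhabited family with genuine fields (the coupling smallness `SmallEpsOmega` is a separate condition on `e·ε₀`).
[cite: Balaban1982Higgs2, Prop. 3.1 p.589, (3.2)–(3.3) p.583, p.567, Lemma 2.3 p.571, (2.55) p.570, (2.7)–(2.8) p.558] -/
theorem exists_hyps_restricted0_field_ne_zero (n : ℕ) (hn1 : 1 ≤ n) (hn2 : n ≤ 2) (d L M : ℕ) (hd2 : 2 ≤ d) (hL : Odd L ∧ 1 < L)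
    {a : ℝ} (ha : 0 < a) (Γ : MinConsts) (hΓ : Γ.Valid) (hcθ : 1 ≤ Γ.cθ * (M : ℝ)) :
    ∃ δ C₁ C₂ R₁ s₁ : ℝ, 0 < δ ∧ 0 ≤ C₁ ∧ 0 ≤ C₂ ∧ 0 < R₁ ∧ 0 < s₁ ∧ s₁ ≤ Γ.ε₀ ∧
      ∀ (Q : B2.Params), Q.d = d → Q.L = L → Q.a = a → R₁ ≤ Q.R → 1 ≤ Q.r → ∀ (m2 : ℝ)
        (P : HiggsLattice.Params) (_S : Shape P), P.d = d → P.L = L → P.M = M → ∀ (K : ℕ), K ≤ P.K → P.mesh K ≤ s₁ →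
        ∀ (bad : (j : ℕ) → Set (HiggsLattice.Site P j)) (v : EuclideanSpace ℝ (Fin P.d)),
          (∀ k, 1 ≤ k → k ≤ K → ‖v‖ ≤ Γ.thrA P.d (P.mesh k)) → v ≠ 0 →
        ∀ (i : ℕ), K = i + 1 → ∀ x : HiggsLattice.Site P 0, blockIter i x ∈ towerRegion bad (towerRad Q P) i 2 →
          ∃ D : RegionsDataN n Q Γ M m2, D.P = P ∧ D.K = K ∧ Hyps D δ C₁ C₂ ∧
            (∀ Γc : B2Prop31Thresholds.Consts, Γc.Valid → Restricted0 D Γc) ∧ D.toRMultiMRN.field ≠ 0 := by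
  obtain ⟨δ, C₁, C₂, hδ, hC₁, hC₂, pkg⟩ := exists_lemma23Bounds d L (by omega) hL ha hΓ.μ0sq_pos Γ.ε₀
  set κ : ℝ := kappaW a L Γ.μ0sq C₂ with hκ
  have hκ0 : 0 ≤ κ := kappaW_nonneg ha hL.2 hΓ.μ0sq_pos.le hC₂.le
  have hLpos : (0 : ℝ) < (L : ℝ) := by exact_mod_cast (lt_trans Nat.zero_lt_one hL.2)
  have hnpos : (0 : ℝ) < (n : ℝ) := by exact_mod_cast (lt_of_lt_of_le Nat.zero_lt_one hn1)
  refine ⟨δ, C₁, C₂, (L : ℝ) / n * (2 / δ + 2 * (M : ℝ) + 8), min Γ.ε₀ (1 / (2 * (κ + 1))), hδ, hC₁.le, hC₂.le, by positivity,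
    lt_min hΓ.ε₀_pos (by positivity), min_le_left _ _, ?_⟩
  intro Q hQd hQL hQa hR hr m2 P S hPd hPL hPM K hK hs bad v hv hv0 i hKi x hx
  subst hQd hQL hQa
  have hR8 : (P.L : ℝ) / n * (2 * (P.M : ℝ) + 8) ≤ Q.R := by
    rw [hPL, hPM]
    have : (Q.L : ℝ) / n * (2 * (M : ℝ) + 8) ≤ (Q.L : ℝ) / n * (2 / δ + 2 * (M : ℝ) + 8) := by
      apply mul_le_mul_of_nonneg_left _ (by positivity)
      have : 0 < 2 / δ := by positivity
      linarith
    exact this.trans hR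
  have hRδ : (P.L : ℝ) / n * (2 / δ + 2 * (P.M : ℝ) + 2) ≤ Q.R := by
    rw [hPL, hPM]
    have : (Q.L : ℝ) / n * (2 / δ + 2 * (M : ℝ) + 2) ≤ (Q.L : ℝ) / n * (2 / δ + 2 * (M : ℝ) + 8) :=
      mul_le_mul_of_nonneg_left (by linarith) (by positivity)
    exact this.trans hR
  have hRQ : (Q.L : ℝ) / n * (2 / δ + 2 * (M : ℝ) + 2) ≤ Q.R := by
    have : (Q.L : ℝ) / n * (2 / δ + 2 * (M : ℝ) + 2) ≤ (Q.L : ℝ) / n * (2 / δ + 2 * (M : ℝ) + 8) :=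
      mul_le_mul_of_nonneg_left (by linarith) (by positivity)
    exact this.trans hR
  have hε₀ : P.mesh K ≤ Γ.ε₀ := hs.trans (min_le_left _ _)
  have hcθ' : 1 ≤ Γ.cθ * (P.M : ℝ) := by rw [hPM]; exact hcθ
  have hsmall : kappaW Q.a Q.L Γ.μ0sq C₂ * P.mesh K < 1 := by
    rw [← hκ]
    have h1 : P.mesh K ≤ 1 / (2 * (κ + 1)) := hs.trans (min_le_right _ _)
    have h2 : κ * P.mesh K ≤ κ * (1 / (2 * (κ + 1))) := mul_le_mul_of_nonneg_left h1 hκ0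
    have h3 : κ * (1 / (2 * (κ + 1))) < 1 := by
      rw [mul_one_div, div_lt_one (by positivity)]
      linarith
    linarith
  have hd2' : 2 ≤ Q.d := hd2
  refine ⟨constData (m2 := m2) hn1 hn2 hΓ P hPL hPd hPM S K hK hε₀ hR8 hr hcθ' bad v, rfl, rfl,
    constData_hyps hn1 hn2 hΓ P hPL hPd hPM S K hK hε₀ hR8 hr hcθ' bad v ha hd2' pkg hδ hC₁.le hC₂.le hRQ hv,
    fun Γc hΓc => constData_restricted0 hn1 hn2 hΓ P hPL hPd hPM S K hK hε₀ hR8 hr hcθ' bad v hΓc, ?_⟩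
  exact constData_field_ne_zero hn1 hn2 hΓ P hPL hPd hPM S K hK hε₀ hR8 hr hcθ' bad v ha pkg hδ hC₂.le hRδ hsmall hv0 hKi hx

end NonVacuity




end Literature.MathematicalPhysics.QuantumFieldTheory.Balaban1983to89.B2Eq298RegularOmega

end
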